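import Mathlib.Analysis.Matrix.PosDef
import Mathlib.MeasureTheory.Integral.Pi
import Mathlib.Analysis.SpecialFunctions.Pow.Real
import Mathlib.Analysis.Calculus.ParametricIntervalIntegral
import Mathlib.Analysis.Complex.AbsMax
import Mathlib.Analysis.Complex.Liouville
import Mathlib.Analysis.Calculus.Deriv.Mul
import Literature.Analysis.Toeplitz.StrongSzegoGeometric
import HarnessLib

/-!
# The strong Szegő limit theorem for continuous symbols: proof of `strongSzego`

Topic `Analysis/Toeplitz`, namespace `Literature.Analysis.Toeplitz`. This file DISCHARGES the named
fact `Literature.Analysis.Toeplitz.strongSzego` of `StrongSzego.lean` (P. Deift, A. Its,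
I. Krasovsky, Comm. Pure Appl. Math. **66** (2013), §3, Theorem 7, in the vendored form: for a
continuous `2π`-periodic `V : ℝ → ℂ` with `∑_{k∈ℤ} |k| |V_k|² < ∞`,
`D_n(e^V) / e^{n V_0} → exp(∑_{k≥1} k V_k V_{-k})`):

* `strongSzego_holds : strongSzego`.

The tree already proves the theorem for symbols with geometrically decaying Fourier coefficients
(`strongSzego_geometric`, `StrongSzegoGeometric.lean`, via von Koch determinants and the
Basor–Helton commutator). The present file extends it to all continuous symbols with
`∑ |k| |V_k|² < ∞` WITHOUT any Hilbert-space operator theory (no trace ideals, no Fredholm theory of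
Toeplitz operators), by the following classical route.

## Real symbols (`h : ℝ → ℝ`; `Φ_n(h) = log D_n(e^h) - n h_0`, `S(h) = ∑_{k≥1} k |h_k|²`)

1. `posDef_toeplitzMatrix`, `toeplitzDet_pos` — `T_n(w)` is positive definite for a continuous
   positive symbol `w` (its quadratic form is `(2π)⁻¹ ∫ w |p_x|²`).
2. `toeplitzDet_succ_succ_mul_le_sq` — **log-concavity in `n`**: `D_{n+2} D_n ≤ D_{n+1}²`
   (Cramer's rule for `(T⁻¹)_{nn}` and completion of the square: `D_{n+1}/D_n = min_{x_n=1} x*T_{n+1}x`,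
   and the Toeplitz shift).
3. `toeplitzDet_mul_eq_integral` — the **Heine–Andréief formula**
   `n! (2π)^n D_n(f) = ∫_{(-π,π]^n} ∏ f(θ_i) |Δ(θ)|² dθ`, `Δ(θ) = det(e^{ikθ_i})` (Leibniz + Fubini +
   symmetrisation over `S_n`); consequences `norm_toeplitzDet_le` (`|D_n(f)| ≤ D_n(|f|)`) and
   `log_toeplitzDet_exp_convex` (**Hölder**: `g ↦ log D_n(e^g)` is convex).
4. Fejér means (`fejerKernel`, `fejerMean`, `tendstoUniformly_fejerMean` — Fejér's theorem;
   `circleCoeff_fejerMean`: `(σ_N h)_k = w_{N,k} h_k`, `0 ≤ w ≤ 1`, `= 0` for `|k| > N`).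
5. `logSzego_fejerMean_le` — **Jensen**: `Φ_n` is convex and translation invariant, `σ_N h` is a
   limit of convex combinations of translates (Riemann sums), and `Φ_n` is continuous under uniform
   convergence, so `Φ_n(σ_N h) ≤ Φ_n(h)`.
6. `logSzego_le_szegoSum_of_geometric` — for geometric symbols `Φ_n ↑` (by 2 and the limit
   `strongSzego_geometric`), hence `Φ_n ≤ S`; with 4–5 this gives `logSzego_le_szegoSum`
   (`Φ_n(h) ≤ S(h)` for all `n`) and `tendsto_logSzego_szegoSum` (`Φ_n(h) → S(h)`): the real case.

## Complex symbols (`V = A + iB`)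

7. `differentiable_szegoQuot_affSymbol` — `z ↦ F_n(A + zB)` is entire (differentiation under the
   integral sign); `norm_szegoQuot_affSymbol_le` — `|F_n(A + zB)| ≤ exp Φ_n(A + (Re z)B)`.
8. `tendsto_atI_of_strip_bound` — a **two-constants lemma**: an entire family with
   `|H_n(x+iy)| ≤ e^{β y²}` and `H_n → 1` pointwise on `ℝ` has `H_n(i) → 1` (Cauchy estimate for
   equicontinuity on `[-T, T]`, then the maximum modulus principle on a rectangle for
   `(H_n - 1) e^{-z²} e^{iKz}`).
9. `strongSzego_holds` — with `H_n(z) = F_n(A + zB) e^{-P(z)}`, `P` the quadratic polynomial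
   summing `∑ k (A_k + zB_k)(A_{-k} + zB_{-k})`, one has `Re P(x+iy) = S(A + xB) - y² S(B)`, so 6–7
   give the strip bound with `β = S(B)`, 6 gives `H_n → 1` on `ℝ`, and 8 concludes at `z = i`.

No new named facts; the definitions (`trigPoly`, `expI`, `vandI`, `circleMeasure`, `torusMeasure`,
`dirichletSum`, `fejerKernel`, `fejerMean`, `fejerCount`, `symbolMean`, `logSzego`, `node`,
`szegoSum`, `szegoQuot`, `affSymbol`) are auxiliary and carry their own API.

## Relation to the tree

A one-dimensional Fejér kernel with the same normalisation (`fejerKernel L = |D_L|²/L`, there with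
`L = N + 1` terms, together with `dirichletSum` and `fejerCount`) exists in
`Literature.Probability.LatticeModels.FejerKernel` (toolkit of the sliding-scale infrared bound), and
another `dirichletSum` (on `UnitAddCircle`) in `Literature.Analysis.FunctionSpaces.LatticeFourier`.
Neither is imported: the former sits on top of the lattice-model stack (`SubcriticalFourier` and its
imports), parts of which import `Analysis/Toeplitz` (`OnsagerSzego.lean` imports
`StrongSzegoGeometric`), so importing it here would invert the dependency between the two topics and
keep the lattice-model files from importing `strongSzego_holds`; the latter lives on the circle
group rather than on `ℝ`. The kernel facts needed here (positivity, unit mass, the bound off `0`)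
take a few lines each; what is new is the Fejér MEAN `fejerMean` of a periodic symbol, its
coefficients, and Fejér's theorem `tendstoUniformly_fejerMean`, which the tree does not have.

## References

* P. Deift, A. Its, I. Krasovsky, Comm. Pure Appl. Math. 66 (2013) 1360–1438, §3, Theorem 7
  (statement; there attributed to K. Johansson 1988 and, for bounded `V`, H. Widom 1976).
* G. Szegő, Comm. Sém. Math. Univ. Lund, tome suppl. (1952) 228–238 (positive symbols).
* Classical ingredients (all proved here): Heine–Andréief identity, Fejér's theorem, Hölder's and
  Jensen's inequalities, the maximum modulus principle (Mathlib's
  `Complex.norm_le_of_forall_mem_frontier_norm_le`) and the Cauchy estimate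
  (`Complex.norm_deriv_le_of_forall_mem_sphere_norm_le`).
-/

noncomputable section

open scoped ComplexConjugate ComplexOrder BigOperators Real
open Filter Complex MeasureTheory intervalIntegral Finset Matrix _root_.Topology

namespace Literature.Analysis.Toeplitz

/-! ### Conjugation symmetry of the coefficients of a real symbol -/

/-- `conj (f_k) = (conj f)_{-k}`. [folklore] -/
theorem conj_circleCoeff (f : ℝ → ℂ) (k : ℤ) :
    conj (circleCoeff f k) = circleCoeff (fun θ => conj (f θ)) (-k) := by
  rw [circleCoeff, circleCoeff, map_mul, ← intervalIntegral_conj]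
  have h2 : conj ((2 * Real.pi : ℂ)⁻¹) = (2 * Real.pi : ℂ)⁻¹ := by
    rw [map_inv₀, map_mul, Complex.conj_ofReal, map_ofNat]
  rw [h2]
  congr 1
  refine intervalIntegral.integral_congr fun θ _ => ?_
  simp only [map_mul, ← Complex.exp_conj, map_neg, Complex.conj_ofReal, Complex.conj_I,
    map_intCast]
  congr 2
  push_cast
  ring

/-- For a real-valued symbol `g`, `conj (g_k) = g_{-k}`. [folklore] -/
theorem conj_circleCoeff_ofReal (g : ℝ → ℝ) (k : ℤ) :
    conj (circleCoeff (fun θ => (g θ : ℂ)) k) = circleCoeff (fun θ => (g θ : ℂ)) (-k) := by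
  rw [conj_circleCoeff]
  simp only [Complex.conj_ofReal]

/-- The Toeplitz matrix of a real symbol is Hermitian. [folklore] -/
theorem isHermitian_toeplitzMatrix_ofReal (g : ℝ → ℝ) (n : ℕ) :
    (toeplitzMatrix (circleCoeff fun θ => (g θ : ℂ)) n).IsHermitian := by
  ext j k
  simp only [conjTranspose_apply, toeplitzMatrix_apply, star_def, conj_circleCoeff_ofReal]
  congr 1
  ring

/-! ### The quadratic form of a Toeplitz matrix -/

/-- The trigonometric polynomial `p_x(θ) = ∑_{k<n} x_k e^{ikθ}` of a coefficient vector. [folklore] -/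
def trigPoly {n : ℕ} (x : Fin n → ℂ) (θ : ℝ) : ℂ :=
  ∑ k : Fin n, x k * Complex.exp (((k : ℕ) : ℂ) * θ * I)

/-- Trigonometric polynomials are continuous. [folklore] -/
theorem continuous_trigPoly {n : ℕ} (x : Fin n → ℂ) : Continuous (trigPoly x) := by
  unfold trigPoly; fun_prop

/-- **The quadratic form of `T_n(f)`**: `x* T_n(f) x = (2π)⁻¹ ∫_{-π}^{π} f(θ) |p_x(θ)|² dθ`. [folklore] -/
theorem star_dotProduct_toeplitzMatrix_mulVec {f : ℝ → ℂ} (hf : Continuous f) {n : ℕ}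
    (x : Fin n → ℂ) :
    star x ⬝ᵥ (toeplitzMatrix (circleCoeff f) n *ᵥ x) =
      (2 * Real.pi : ℂ)⁻¹ * ∫ θ in (-Real.pi)..Real.pi,
        f θ * (conj (trigPoly x θ) * trigPoly x θ) := by
  -- expand the left-hand side as a double sum of coefficients
  have hL : star x ⬝ᵥ (toeplitzMatrix (circleCoeff f) n *ᵥ x) =
      ∑ j : Fin n, ∑ k : Fin n, conj (x j) * x k * circleCoeff f ((j : ℤ) - (k : ℤ)) := by
    simp only [dotProduct, mulVec, Pi.star_apply, star_def, toeplitzMatrix_apply, Finset.mul_sum]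
    refine Finset.sum_congr rfl fun j _ => Finset.sum_congr rfl fun k _ => ?_
    ring
  -- conjugates of the exponentials
  have hconj : ∀ (m : ℕ) (θ : ℝ), conj (Complex.exp (((m : ℕ) : ℂ) * θ * I)) =
      Complex.exp (-(((m : ℕ) : ℂ) * θ * I)) := by
    intro m θ
    rw [← Complex.exp_conj, map_mul, map_mul, map_natCast, Complex.conj_ofReal, Complex.conj_I]
    congr 1; ring
  -- each coefficient as an integral
  have hcoef : ∀ j k : Fin n, conj (x j) * x k * circleCoeff f ((j : ℤ) - (k : ℤ)) =
      (2 * Real.pi : ℂ)⁻¹ * ∫ θ in (-Real.pi)..Real.pi,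
        f θ * (conj (x j * Complex.exp (((j : ℕ) : ℂ) * θ * I)) *
          (x k * Complex.exp (((k : ℕ) : ℂ) * θ * I))) := by
    intro j k
    rw [circleCoeff, ← mul_assoc, mul_comm (conj (x j) * x k), mul_assoc,
      ← intervalIntegral.integral_const_mul]
    congr 1
    refine intervalIntegral.integral_congr fun θ _ => ?_
    rw [map_mul, hconj]
    have : Complex.exp (-(((j : ℤ) - (k : ℤ) : ℤ) * (θ : ℂ) * I)) =
        Complex.exp (-(((j : ℕ) : ℂ) * (θ : ℂ) * I)) * Complex.exp (((k : ℕ) : ℂ) * θ * I) := by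
      rw [← Complex.exp_add]; congr 1; push_cast; ring
    rw [this]; ring
  have hint : ∀ j k : Fin n, IntervalIntegrable (fun θ : ℝ =>
      f θ * (conj (x j * Complex.exp (((j : ℕ) : ℂ) * θ * I)) *
        (x k * Complex.exp (((k : ℕ) : ℂ) * θ * I)))) volume (-Real.pi) Real.pi := by
    intro j k
    apply Continuous.intervalIntegrable
    have hc : Continuous fun θ : ℝ => conj (x j * Complex.exp (((j : ℕ) : ℂ) * θ * I)) :=
      Complex.continuous_conj.comp (by fun_prop)
    fun_prop
  rw [hL]
  simp_rw [hcoef]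
  rw [intervalIntegral.integral_congr (g := fun θ => ∑ j : Fin n, ∑ k : Fin n,
      f θ * (conj (x j * Complex.exp (((j : ℕ) : ℂ) * θ * I)) *
        (x k * Complex.exp (((k : ℕ) : ℂ) * θ * I)))) ?_]
  · rw [intervalIntegral.integral_finsetSum, Finset.mul_sum]
    · refine Finset.sum_congr rfl fun j _ => ?_
      rw [intervalIntegral.integral_finsetSum (fun k _ => hint j k), Finset.mul_sum]
    · intro j _
      refine Continuous.intervalIntegrable (continuous_finsetSum _ fun k _ => ?_) _ _
      have hc : Continuous fun θ : ℝ => conj (x j * Complex.exp (((j : ℕ) : ℂ) * θ * I)) :=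
        Complex.continuous_conj.comp (by fun_prop)
      fun_prop
  · intro θ _
    simp only [trigPoly, map_sum, Finset.sum_mul, Finset.mul_sum]
    rw [Finset.sum_comm]

/-- The coefficients of a pure exponential with natural frequency. [folklore] -/
theorem circleCoeff_cexp_nat_mul (m : ℕ) (j : ℤ) :
    circleCoeff (fun θ : ℝ => Complex.exp ((m : ℂ) * θ * I)) j = if j = m then 1 else 0 := by
  have h := circleCoeff_cexp_int_mul (m : ℤ) j
  push_cast at h
  exact h

/-- **Coefficient extraction** for trigonometric polynomials: `(p_x)_k = x_k`. [folklore] -/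
theorem circleCoeff_trigPoly {n : ℕ} (x : Fin n → ℂ) (k : Fin n) :
    circleCoeff (trigPoly x) ((k : ℕ) : ℤ) = x k := by
  unfold trigPoly
  rw [circleCoeff_finset_sum _ _ (fun i _ => by fun_prop)]
  simp_rw [circleCoeff_const_mul, circleCoeff_cexp_nat_mul]
  simp only [Nat.cast_inj, mul_ite, mul_one, mul_zero, Fin.val_inj, Finset.sum_ite_eq,
    Finset.mem_univ, if_true]

/-- A nonzero coefficient vector gives a trigonometric polynomial that does not vanish
identically on `[-π, π]`. [folklore] -/
theorem exists_trigPoly_ne_zero {n : ℕ} {x : Fin n → ℂ} (hx : x ≠ 0) :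
    ∃ θ ∈ Set.Icc (-Real.pi) Real.pi, trigPoly x θ ≠ 0 := by
  by_contra h
  simp only [not_exists, not_and, not_not] at h
  apply hx
  funext k
  rw [Pi.zero_apply, ← circleCoeff_trigPoly x k, circleCoeff]
  rw [intervalIntegral.integral_congr (g := fun _ => (0 : ℂ)) fun θ hθ => ?_]
  · simp
  · have hθ' : θ ∈ Set.Icc (-Real.pi) Real.pi := by
      rwa [Set.uIcc_of_le (by linarith [Real.pi_pos])] at hθ
    simp [h θ hθ']

/-- **Positive definiteness**: the Toeplitz matrix `T_n(w)` of a continuous positive symbol `w`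
is positive definite (its quadratic form is `(2π)⁻¹ ∫ w |p_x|² > 0` for `x ≠ 0`). [folklore] -/
theorem posDef_toeplitzMatrix {w : ℝ → ℝ} (hw : Continuous w) (hpos : ∀ θ, 0 < w θ) (n : ℕ) :
    (toeplitzMatrix (circleCoeff fun θ => (w θ : ℂ)) n).PosDef := by
  refine PosDef.of_dotProduct_mulVec_pos (isHermitian_toeplitzMatrix_ofReal w n) fun x hx => ?_
  rw [star_dotProduct_toeplitzMatrix_mulVec (f := fun θ => (w θ : ℂ)) (by fun_prop)]
  have hI : (∫ θ in (-Real.pi)..Real.pi, ((w θ : ℝ) : ℂ) * (conj (trigPoly x θ) * trigPoly x θ)) =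
      ((∫ θ in (-Real.pi)..Real.pi, w θ * ‖trigPoly x θ‖ ^ 2 : ℝ) : ℂ) := by
    rw [← intervalIntegral.integral_ofReal]
    refine intervalIntegral.integral_congr fun θ _ => ?_
    simp only [conj_mul_eq_ofReal_norm_sq]
    push_cast; ring
  rw [hI, show (2 * Real.pi : ℂ)⁻¹ = (((2 * Real.pi)⁻¹ : ℝ) : ℂ) by push_cast; rfl,
    ← Complex.ofReal_mul, Complex.zero_lt_real]
  refine mul_pos (inv_pos.2 Real.two_pi_pos) ?_
  have hp := continuous_trigPoly x
  have h0 : (∫ _ in (-Real.pi)..Real.pi, (0 : ℝ)) = 0 := by simp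
  rw [← h0]
  refine intervalIntegral.integral_lt_integral_of_continuousOn_of_le_of_exists_lt
    (by linarith [Real.pi_pos]) continuousOn_const (Continuous.continuousOn (by fun_prop))
    (fun θ _ => (mul_nonneg (hpos θ).le (by positivity) : (0 : ℝ) ≤ w θ * ‖trigPoly x θ‖ ^ 2)) ?_
  obtain ⟨θ, hθ, hne⟩ := exists_trigPoly_ne_zero hx
  exact ⟨θ, hθ, (mul_pos (hpos θ) (by positivity) : (0 : ℝ) < w θ * ‖trigPoly x θ‖ ^ 2)⟩

/-- The Toeplitz determinant of a continuous positive symbol is a positive real number. [folklore] -/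
theorem toeplitzDet_pos {w : ℝ → ℝ} (hw : Continuous w) (hpos : ∀ θ, 0 < w θ) (n : ℕ) :
    0 < (toeplitzDet (circleCoeff fun θ => (w θ : ℂ)) n).re ∧
      (toeplitzDet (circleCoeff fun θ => (w θ : ℂ)) n).im = 0 := by
  have h := (posDef_toeplitzMatrix hw hpos n).det_pos
  rw [Complex.pos_iff] at h
  exact ⟨h.1, h.2.symm⟩

/-! ### Monotonicity of the ratios `D_{n+1}/D_n` (log-concavity of `n ↦ D_n`) -/

section Ratio

variable {m : ℕ}

/-- **Cramer's rule for the last diagonal cofactor**: `adj(A)_{mm} = det A'`, `A'` the leading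
principal `m × m` block. [folklore] -/
theorem adjugate_last_last (A : Matrix (Fin (m + 1)) (Fin (m + 1)) ℂ) :
    A.adjugate (Fin.last m) (Fin.last m) = (A.submatrix Fin.castSucc Fin.castSucc).det := by
  rw [adjugate_fin_succ_eq_det_submatrix, Fin.succAbove_last]
  have h1 : (-1 : ℂ) ^ ((Fin.last m : ℕ) + (Fin.last m : ℕ)) = 1 :=
    Even.neg_one_pow ⟨(Fin.last m : ℕ), rfl⟩
  rw [h1, one_mul]

/-- `(A⁻¹)_{mm} · det A = det A'` for invertible `A`. [folklore] -/
theorem inv_apply_last_mul_det (A : Matrix (Fin (m + 1)) (Fin (m + 1)) ℂ) (hA : IsUnit A.det) :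
    A⁻¹ (Fin.last m) (Fin.last m) * A.det = (A.submatrix Fin.castSucc Fin.castSucc).det := by
  rw [Matrix.inv_def, Matrix.smul_apply, smul_eq_mul, adjugate_last_last]
  calc Ring.inverse A.det * (A.submatrix Fin.castSucc Fin.castSucc).det * A.det
      = A.det * Ring.inverse A.det * (A.submatrix Fin.castSucc Fin.castSucc).det := by ring
    _ = (A.submatrix Fin.castSucc Fin.castSucc).det := by
      rw [Ring.mul_inverse_cancel _ hA, one_mul]

/-- The vector `u = A⁻¹ e_last` represents the last coordinate for the form `v* A w`:
`u* A w = w_last` (`A` positive definite). [folklore] -/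
theorem star_inv_mulVec_single_dotProduct {A : Matrix (Fin (m + 1)) (Fin (m + 1)) ℂ}
    (hA : A.PosDef) (w : Fin (m + 1) → ℂ) :
    star (A⁻¹ *ᵥ Pi.single (Fin.last m) 1) ⬝ᵥ (A *ᵥ w) = w (Fin.last m) := by
  have hunit : IsUnit A.det := (isUnit_iff_isUnit_det A).1 hA.isUnit
  have hAu : A *ᵥ (A⁻¹ *ᵥ Pi.single (Fin.last m) (1 : ℂ)) = Pi.single (Fin.last m) 1 := by
    rw [mulVec_mulVec, mul_nonsing_inv A hunit, one_mulVec]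
  have h2 := star_mulVec A (A⁻¹ *ᵥ Pi.single (Fin.last m) (1 : ℂ))
  rw [hA.1.eq, hAu, ← Pi.single_star, star_one] at h2
  rw [dotProduct_mulVec, ← h2, single_dotProduct, one_mul]

/-- **Variational bound**: for a positive definite `A` and any `x` with `x_last = 1`,
`det A ≤ det A' · x* A x` (real parts; all quantities are real). [folklore] -/
theorem det_re_le_det_submatrix_re_mul {A : Matrix (Fin (m + 1)) (Fin (m + 1)) ℂ}
    (hA : A.PosDef) (x : Fin (m + 1) → ℂ) (hx : x (Fin.last m) = 1) :
    A.det.re ≤ (A.submatrix Fin.castSucc Fin.castSucc).det.re * (star x ⬝ᵥ (A *ᵥ x)).re := by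
  set l := Fin.last m with hl
  have hunit : IsUnit A.det := (isUnit_iff_isUnit_det A).1 hA.isUnit
  set B := A⁻¹ with hB
  have hBpd : B.PosDef := hA.inv
  set u : Fin (m + 1) → ℂ := B *ᵥ Pi.single l 1 with hu
  have hAu : A *ᵥ u = Pi.single l 1 := by
    rw [hu, mulVec_mulVec, hB, mul_nonsing_inv A hunit, one_mulVec]
  have hux : ∀ w, star u ⬝ᵥ (A *ᵥ w) = w l := star_inv_mulVec_single_dotProduct hA
  have hwu : ∀ w : Fin (m + 1) → ℂ, star w ⬝ᵥ (A *ᵥ u) = conj (w l) := fun w => by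
    rw [hAu, dotProduct_single, mul_one, Pi.star_apply, star_def]
  have hul : u l = B l l := by
    rw [hu]; simp [mulVec, dotProduct_single]
  -- `B l l` is a positive real
  have hBll := hBpd.diag_pos (i := l)
  rw [Complex.pos_iff] at hBll
  have hBre : 0 < (B l l).re := hBll.1
  have hBreal : ((B l l).re : ℂ) = B l l := Complex.ext rfl hBll.2
  -- Cramer
  have hcr : (A.submatrix Fin.castSucc Fin.castSucc).det.re = (B l l).re * A.det.re := by
    have h := inv_apply_last_mul_det A hunit
    rw [← hB] at h
    rw [← h, ← hBreal, Complex.re_ofReal_mul, Complex.ofReal_re]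
  -- complete the square: `x = w + s • u`, `s = 1 / B l l`
  set s : ℂ := ((((B l l).re)⁻¹ : ℝ) : ℂ) with hs
  set w : Fin (m + 1) → ℂ := x - s • u with hw
  have hwl : w l = 0 := by
    rw [hw, Pi.sub_apply, Pi.smul_apply, hx, hul, smul_eq_mul, ← hBreal, hs]
    push_cast
    field_simp
    ring
  have hxdec : x = w + s • u := by rw [hw, sub_add_cancel]
  have hexp : star x ⬝ᵥ (A *ᵥ x) = star w ⬝ᵥ (A *ᵥ w) + s := by
    rw [hxdec, mulVec_add, mulVec_smul, star_add, star_smul, add_dotProduct, dotProduct_add,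
      dotProduct_add, smul_dotProduct, smul_dotProduct, dotProduct_smul, dotProduct_smul,
      hux w, hwu w, hux u, hwl, hul]
    simp only [map_zero, smul_eq_mul]
    rw [← hBreal, hs, show star (((B l l).re⁻¹ : ℝ) : ℂ) = (((B l l).re⁻¹ : ℝ) : ℂ) from
      Complex.conj_ofReal _]
    push_cast
    field_simp
    ring
  have hwnn : 0 ≤ (star w ⬝ᵥ (A *ᵥ w)).re := by
    have := hA.posSemidef.dotProduct_mulVec_nonneg w
    rw [Complex.nonneg_iff] at this
    exact this.1
  have hdet : 0 < A.det.re := by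
    have := hA.det_pos; rw [Complex.pos_iff] at this; exact this.1
  rw [hcr, hexp, Complex.add_re, hs, Complex.ofReal_re]
  have : (B l l).re * A.det.re * ((star w ⬝ᵥ (A *ᵥ w)).re + ((B l l).re)⁻¹) =
      A.det.re + (B l l).re * A.det.re * (star w ⬝ᵥ (A *ᵥ w)).re := by
    field_simp
    ring
  rw [this]
  nlinarith [mul_nonneg (mul_nonneg hBre.le hdet.le) hwnn]

/-- **Attainment**: the bound of `det_re_le_det_submatrix_re_mul` is attained at
`x = A⁻¹ e_last / (A⁻¹)_{last,last}`. [folklore] -/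
theorem exists_det_eq_det_submatrix_mul {A : Matrix (Fin (m + 1)) (Fin (m + 1)) ℂ}
    (hA : A.PosDef) : ∃ x : Fin (m + 1) → ℂ, x (Fin.last m) = 1 ∧
      A.det.re = (A.submatrix Fin.castSucc Fin.castSucc).det.re * (star x ⬝ᵥ (A *ᵥ x)).re := by
  set l := Fin.last m with hl
  have hunit : IsUnit A.det := (isUnit_iff_isUnit_det A).1 hA.isUnit
  set B := A⁻¹ with hB
  have hBpd : B.PosDef := hA.inv
  set u : Fin (m + 1) → ℂ := B *ᵥ Pi.single l 1 with hu
  have hAu : A *ᵥ u = Pi.single l 1 := by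
    rw [hu, mulVec_mulVec, hB, mul_nonsing_inv A hunit, one_mulVec]
  have hux : ∀ w, star u ⬝ᵥ (A *ᵥ w) = w l := star_inv_mulVec_single_dotProduct hA
  have hul : u l = B l l := by
    rw [hu]; simp [mulVec, dotProduct_single]
  have hBll := hBpd.diag_pos (i := l)
  rw [Complex.pos_iff] at hBll
  have hBre : 0 < (B l l).re := hBll.1
  have hBreal : ((B l l).re : ℂ) = B l l := Complex.ext rfl hBll.2
  have hcr : (A.submatrix Fin.castSucc Fin.castSucc).det.re = (B l l).re * A.det.re := by
    have h := inv_apply_last_mul_det A hunit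
    rw [← hB] at h
    rw [← h, ← hBreal, Complex.re_ofReal_mul, Complex.ofReal_re]
  set s : ℂ := ((((B l l).re)⁻¹ : ℝ) : ℂ) with hs
  refine ⟨s • u, ?_, ?_⟩
  · rw [Pi.smul_apply, hul, smul_eq_mul, ← hBreal, hs]
    push_cast
    field_simp
  · rw [mulVec_smul, star_smul, smul_dotProduct, dotProduct_smul, hux u, hul, ← hBreal, hs,
      show star (((B l l).re⁻¹ : ℝ) : ℂ) = (((B l l).re⁻¹ : ℝ) : ℂ) from Complex.conj_ofReal _,
      hcr]
    simp only [smul_eq_mul]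
    push_cast
    rw [show ((((B l l).re : ℂ))⁻¹ * ((((B l l).re : ℂ))⁻¹ * ((B l l).re : ℂ))) =
      (((B l l).re⁻¹ : ℝ) : ℂ) by push_cast; field_simp, Complex.ofReal_re]
    field_simp

/-- The leading principal block of a Toeplitz matrix is the smaller Toeplitz matrix. [folklore] -/
theorem submatrix_castSucc_toeplitzMatrix (c : ℤ → ℂ) (n : ℕ) :
    (toeplitzMatrix c (n + 1)).submatrix Fin.castSucc Fin.castSucc = toeplitzMatrix c n := by
  ext j k
  simp [toeplitzMatrix_apply]

/-- **Toeplitz shift invariance of the quadratic form**: padding a vector with a leading zero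
does not change `x* T x`. [folklore] -/
theorem star_cons_dotProduct_toeplitzMatrix_mulVec (c : ℤ → ℂ) (n : ℕ) (y : Fin (n + 1) → ℂ) :
    star (Fin.cons 0 y : Fin (n + 2) → ℂ) ⬝ᵥ (toeplitzMatrix c (n + 2) *ᵥ (Fin.cons 0 y)) =
      star y ⬝ᵥ (toeplitzMatrix c (n + 1) *ᵥ y) := by
  simp only [dotProduct, mulVec, Pi.star_apply, toeplitzMatrix_apply]
  rw [Fin.sum_univ_succ]
  simp only [Fin.cons_zero, star_zero, zero_mul, zero_add, Fin.cons_succ]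
  refine Finset.sum_congr rfl fun j _ => ?_
  congr 1
  rw [Fin.sum_univ_succ]
  simp only [Fin.cons_zero, mul_zero, zero_add, Fin.cons_succ]
  refine Finset.sum_congr rfl fun k _ => ?_
  congr 2
  simp only [Fin.val_succ]
  push_cast
  ring

/-- **Log-concavity of Toeplitz determinants of a positive symbol**:
`D_{n+2} D_n ≤ D_{n+1}²`, i.e. the ratios `D_{n+1}/D_n` decrease (Szegő; equivalently the
minimum of `x* T_{n+1} x` over `x_n = 1` decreases with `n`). [folklore] -/
theorem toeplitzDet_succ_succ_mul_le_sq {w : ℝ → ℝ} (hw : Continuous w) (hpos : ∀ θ, 0 < w θ)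
    (n : ℕ) :
    (toeplitzDet (circleCoeff fun θ => (w θ : ℂ)) (n + 2)).re *
        (toeplitzDet (circleCoeff fun θ => (w θ : ℂ)) n).re ≤
      (toeplitzDet (circleCoeff fun θ => (w θ : ℂ)) (n + 1)).re ^ 2 := by
  set c := circleCoeff fun θ => (w θ : ℂ) with hc
  have hpd := fun k => posDef_toeplitzMatrix hw hpos k
  obtain ⟨y, hy1, hy⟩ := exists_det_eq_det_submatrix_mul (hpd (n + 1))
  rw [submatrix_castSucc_toeplitzMatrix] at hy
  set x : Fin (n + 2) → ℂ := Fin.cons 0 y with hx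
  have hx1 : x (Fin.last (n + 1)) = 1 := by
    rw [hx, ← Fin.succ_last, Fin.cons_succ]; exact hy1
  have h1 := det_re_le_det_submatrix_re_mul (hpd (n + 2)) x hx1
  rw [submatrix_castSucc_toeplitzMatrix, hx, star_cons_dotProduct_toeplitzMatrix_mulVec] at h1
  have hDn : 0 < (toeplitzDet c n).re := (toeplitzDet_pos hw hpos n).1
  change ((toeplitzMatrix c (n + 2)).det).re * ((toeplitzMatrix c n).det).re ≤
    ((toeplitzMatrix c (n + 1)).det).re ^ 2
  change ((toeplitzMatrix c (n + 1)).det).re =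
    ((toeplitzMatrix c n).det).re * (star y ⬝ᵥ (toeplitzMatrix c (n + 1) *ᵥ y)).re at hy
  change 0 < ((toeplitzMatrix c n).det).re at hDn
  calc ((toeplitzMatrix c (n + 2)).det).re * ((toeplitzMatrix c n).det).re
      ≤ ((toeplitzMatrix c (n + 1)).det).re * (star y ⬝ᵥ (toeplitzMatrix c (n + 1) *ᵥ y)).re *
          ((toeplitzMatrix c n).det).re := mul_le_mul_of_nonneg_right h1 hDn.le
    _ = ((toeplitzMatrix c (n + 1)).det).re ^ 2 := by rw [hy]; ring

end Ratio

/-! ### The Heine–Andréief formula for Toeplitz determinants -/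

section Andreief

open Equiv

/-- The exponentials `e_k(x) = e^{ikx}`, `k ∈ ℕ`. [folklore] -/
def expI (k : ℕ) (x : ℝ) : ℂ := Complex.exp ((k : ℂ) * x * I)

/-- The exponentials `e_k` are continuous. [folklore] -/
theorem continuous_expI (k : ℕ) : Continuous (expI k) := by unfold expI; fun_prop

/-- `conj e_k(x) = e^{-ikx}`. [folklore] -/
theorem conj_expI (k : ℕ) (x : ℝ) : conj (expI k x) = Complex.exp (-((k : ℂ) * x * I)) := by
  rw [expI, ← Complex.exp_conj, map_mul, map_mul, map_natCast, Complex.conj_ofReal, Complex.conj_I]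
  congr 1; ring

/-- The conjugate exponentials are continuous. [folklore] -/
theorem continuous_conj_expI (k : ℕ) : Continuous fun x => conj (expI k x) :=
  Complex.continuous_conj.comp (continuous_expI k)

/-- The **Vandermonde-type determinant** `Δ(θ) = det (e^{ikθ_i})_{k,i<n}`. [folklore] -/
def vandI (n : ℕ) (θ : Fin n → ℝ) : ℂ := (Matrix.of fun k i : Fin n => expI k (θ i)).det

/-- Leibniz expansion of `Δ`. [folklore] -/
theorem vandI_eq_sum (n : ℕ) (θ : Fin n → ℝ) :
    vandI n θ = ∑ σ : Perm (Fin n), (Perm.sign σ : ℂ) * ∏ i, expI (σ i) (θ i) := by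
  rw [vandI, det_apply']
  rfl

/-- `Δ` is continuous. [folklore] -/
theorem continuous_vandI (n : ℕ) : Continuous (vandI n) := by
  unfold vandI
  refine Continuous.matrix_det ?_
  refine continuous_pi fun k => continuous_pi fun i => ?_
  exact (continuous_expI k).comp (continuous_apply i)

/-- Permuting the variables multiplies `Δ` by the sign. [folklore] -/
theorem vandI_comp_perm (n : ℕ) (θ : Fin n → ℝ) (τ : Perm (Fin n)) :
    vandI n (fun i => θ (τ i)) = (Perm.sign τ : ℂ) * vandI n θ := by
  rw [vandI, vandI, ← det_permute']
  rfl

/-- The restricted Lebesgue measure on `(-π, π]`. [folklore] -/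
def circleMeasure : Measure ℝ := (volume : Measure ℝ).restrict (Set.Ioc (-Real.pi) Real.pi)

/-- `circleMeasure` is finite. [folklore] -/
instance : IsFiniteMeasure circleMeasure := by
  unfold circleMeasure; infer_instance

/-- `circleMeasure` is σ-finite. [folklore] -/
instance : SigmaFinite circleMeasure := by
  unfold circleMeasure; infer_instance

/-- The product measure on `(-π, π]^n`. [folklore] -/
def torusMeasure (n : ℕ) : Measure (Fin n → ℝ) := Measure.pi fun _ : Fin n => circleMeasure

/-- `torusMeasure n` is finite. [folklore] -/
instance (n : ℕ) : IsFiniteMeasure (torusMeasure n) := by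
  unfold torusMeasure; infer_instance

/-- The torus measure is Lebesgue measure restricted to the box `(-π, π]^n`. [folklore] -/
theorem torusMeasure_eq_restrict (n : ℕ) :
    torusMeasure n = (volume : Measure (Fin n → ℝ)).restrict
      (Set.univ.pi fun _ => Set.Ioc (-Real.pi) Real.pi) := by
  rw [torusMeasure, volume_pi, Measure.restrict_pi_pi]
  rfl

/-- Continuous functions are integrable on the torus `(-π, π]^n`. [folklore] -/
theorem integrable_torus_of_continuous {n : ℕ} {H : (Fin n → ℝ) → ℂ} (hH : Continuous H) :
    Integrable H (torusMeasure n) := by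
  rw [torusMeasure_eq_restrict]
  exact (hH.continuousOn.integrableOn_compact
    (isCompact_univ_pi fun _ => isCompact_Icc)).mono_set (Set.pi_mono fun _ _ => Set.Ioc_subset_Icc_self)

/-- Permutation invariance of the torus measure (integral form). [folklore] -/
theorem integral_torus_comp_perm {n : ℕ} (τ : Perm (Fin n)) (H : (Fin n → ℝ) → ℂ) :
    ∫ θ, H (fun i => θ (τ i)) ∂(torusMeasure n) = ∫ θ, H θ ∂(torusMeasure n) := by
  have h := (measurePreserving_piCongrLeft (fun _ : Fin n => circleMeasure) τ.symm).integral_comp'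
    (f := MeasurableEquiv.piCongrLeft (fun _ : Fin n => ℝ) τ.symm) H
  refine Eq.trans ?_ h
  unfold torusMeasure
  congr 1
  funext θ
  congr 1
  funext i
  simp [MeasurableEquiv.piCongrLeft, Equiv.piCongrLeft_apply_eq_cast]

/-- A Fourier coefficient with a difference frequency, as an integral over `circleMeasure`:
`f_{k-i} = (2π)⁻¹ ∫ f · conj(e_k) e_i`. [folklore] -/
theorem circleCoeff_sub_eq_integral (f : ℝ → ℂ) (k i : ℕ) :
    circleCoeff f ((k : ℤ) - (i : ℤ)) =
      (2 * Real.pi : ℂ)⁻¹ * ∫ x, f x * (conj (expI k x) * expI i x) ∂circleMeasure := by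
  rw [circleCoeff, intervalIntegral.integral_of_le (by linarith [Real.pi_pos]), circleMeasure]
  congr 1
  refine integral_congr_ae (Eventually.of_forall fun x => ?_)
  simp only
  rw [conj_expI, expI, mul_comm (f x), ← Complex.exp_add]
  congr 2
  push_cast
  ring

/-- **Heine–Andréief formula**: for a continuous symbol `f`,
`n! (2π)^n D_n(f) = ∫_{(-π,π]^n} ∏_i f(θ_i) |Δ(θ)|² dθ`. [folklore] -/
theorem toeplitzDet_mul_eq_integral {f : ℝ → ℂ} (hf : Continuous f) (n : ℕ) :
    toeplitzDet (circleCoeff f) n * ((2 * Real.pi : ℂ) ^ n * n.factorial) =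
      ∫ θ, (∏ i, f (θ i)) * (conj (vandI n θ) * vandI n θ) ∂(torusMeasure n) := by
  -- Step 1: Leibniz expansion
  have hdet : toeplitzDet (circleCoeff f) n =
      ∑ σ : Perm (Fin n), (Perm.sign σ : ℂ) * ∏ i, circleCoeff f (((σ i : ℕ) : ℤ) - ((i : ℕ) : ℤ)) := by
    rw [toeplitzDet, det_apply']
    rfl
  -- Step 2/3: each product of coefficients is an integral over the torus
  set G : Perm (Fin n) → (Fin n → ℝ) → ℂ :=
    fun σ θ => ∏ i, (f (θ i) * (conj (expI (σ i) (θ i)) * expI i (θ i))) with hG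
  have hGc : ∀ σ, Continuous (G σ) := by
    intro σ
    refine continuous_finsetProd _ fun i _ => ?_
    exact ((hf.comp (continuous_apply i)).mul
      (((continuous_conj_expI _).comp (continuous_apply i)).mul
        ((continuous_expI _).comp (continuous_apply i))))
  have hprod : ∀ σ : Perm (Fin n), (∏ i, circleCoeff f (((σ i : ℕ) : ℤ) - ((i : ℕ) : ℤ))) =
      ((2 * Real.pi : ℂ) ^ n)⁻¹ * ∫ θ, G σ θ ∂(torusMeasure n) := by
    intro σ
    simp_rw [circleCoeff_sub_eq_integral]
    rw [Finset.prod_mul_distrib, Finset.prod_const, Finset.card_univ, Fintype.card_fin, inv_pow,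
      hG, torusMeasure]
    congr 1
    exact (integral_fintype_prod_eq_prod (𝕜 := ℂ)
      (fun i x => f x * (conj (expI (σ i) x) * expI i x))).symm
  -- Step 4/5: sum inside, pointwise Leibniz for `conj Δ`
  have hpt : ∀ θ : Fin n → ℝ, ∑ σ : Perm (Fin n), (Perm.sign σ : ℂ) * G σ θ =
      (∏ i, f (θ i) * expI i (θ i)) * conj (vandI n θ) := by
    intro θ
    rw [vandI_eq_sum, map_sum, Finset.mul_sum]
    refine Finset.sum_congr rfl fun σ _ => ?_
    rw [map_mul, map_intCast, map_prod, hG]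
    simp only
    rw [show (∏ i, f (θ i) * (conj (expI (σ i) (θ i)) * expI i (θ i))) =
        (∏ i, f (θ i) * expI i (θ i)) * ∏ i, conj (expI (σ i) (θ i)) by
      rw [← Finset.prod_mul_distrib]; exact Finset.prod_congr rfl fun i _ => by ring]
    ring
  have hI : toeplitzDet (circleCoeff f) n * (2 * Real.pi : ℂ) ^ n =
      ∫ θ, (∏ i, f (θ i) * expI i (θ i)) * conj (vandI n θ) ∂(torusMeasure n) := by
    have h2π : (2 * Real.pi : ℂ) ^ n ≠ 0 := pow_ne_zero _ (by exact_mod_cast Real.two_pi_pos.ne')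
    rw [hdet]
    simp_rw [hprod]
    rw [Finset.sum_mul]
    have : ∀ σ : Perm (Fin n), (Perm.sign σ : ℂ) * (((2 * Real.pi : ℂ) ^ n)⁻¹ *
        ∫ θ, G σ θ ∂(torusMeasure n)) * (2 * Real.pi : ℂ) ^ n =
        ∫ θ, (Perm.sign σ : ℂ) * G σ θ ∂(torusMeasure n) := by
      intro σ
      rw [MeasureTheory.integral_const_mul]
      field_simp
    simp_rw [this]
    rw [← integral_finsetSum _ (fun σ _ => (integrable_torus_of_continuous (hGc σ)).const_mul _)]
    exact integral_congr_ae (Eventually.of_forall hpt)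
  -- Step 6: symmetrization
  set F : (Fin n → ℝ) → ℂ := fun θ => ∏ i, f (θ i) with hF
  have hFc : Continuous F := continuous_finsetProd _ fun i _ => hf.comp (continuous_apply i)
  have hτ : ∀ τ : Perm (Fin n),
      (∫ θ, (∏ i, f (θ i) * expI i (θ i)) * conj (vandI n θ) ∂(torusMeasure n)) =
        ∫ θ, F θ * conj (vandI n θ) * ((Perm.sign τ : ℂ) * ∏ j, expI (τ.symm j) (θ j))
          ∂(torusMeasure n) := by
    intro τ
    rw [← integral_torus_comp_perm τ]
    refine integral_congr_ae (Eventually.of_forall fun θ => ?_)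
    simp only
    rw [vandI_comp_perm, map_mul, map_intCast, Finset.prod_mul_distrib,
      Equiv.prod_comp τ (fun j => f (θ j))]
    have hre : (∏ i : Fin n, expI i (θ (τ i))) = ∏ j : Fin n, expI (τ.symm j) (θ j) := by
      rw [← Equiv.prod_comp τ.symm (fun i : Fin n => expI i (θ (τ i)))]
      simp only [Equiv.apply_symm_apply]
    rw [hre, hF]
    ring
  have hsum : ∀ θ : Fin n → ℝ,
      ∑ τ : Perm (Fin n), (Perm.sign τ : ℂ) * ∏ j, expI (τ.symm j) (θ j) = vandI n θ := by
    intro θ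
    rw [vandI_eq_sum, ← Equiv.sum_comp (Equiv.inv (Perm (Fin n)))]
    refine Finset.sum_congr rfl fun τ _ => ?_
    simp only [Equiv.inv_apply, Perm.sign_inv]
    rfl
  have hint2 : ∀ τ : Perm (Fin n), Integrable (fun θ => F θ * conj (vandI n θ) *
      ((Perm.sign τ : ℂ) * ∏ j, expI (τ.symm j) (θ j))) (torusMeasure n) := by
    intro τ
    refine integrable_torus_of_continuous ?_
    refine (hFc.mul (Complex.continuous_conj.comp (continuous_vandI n))).mul
      (continuous_const.mul (continuous_finsetProd _ fun j _ => ?_))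
    exact (continuous_expI _).comp (continuous_apply j)
  calc toeplitzDet (circleCoeff f) n * ((2 * Real.pi : ℂ) ^ n * n.factorial)
      = ∑ _τ : Perm (Fin n), toeplitzDet (circleCoeff f) n * (2 * Real.pi : ℂ) ^ n := by
        rw [Finset.sum_const, Finset.card_univ, Fintype.card_perm, Fintype.card_fin, nsmul_eq_mul]
        ring
    _ = ∑ τ : Perm (Fin n), ∫ θ, F θ * conj (vandI n θ) *
          ((Perm.sign τ : ℂ) * ∏ j, expI (τ.symm j) (θ j)) ∂(torusMeasure n) := by
        refine Finset.sum_congr rfl fun τ _ => ?_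
        rw [hI, hτ τ]
    _ = ∫ θ, ∑ τ : Perm (Fin n), F θ * conj (vandI n θ) *
          ((Perm.sign τ : ℂ) * ∏ j, expI (τ.symm j) (θ j)) ∂(torusMeasure n) :=
        (integral_finsetSum _ (fun τ _ => hint2 τ)).symm
    _ = ∫ θ, (∏ i, f (θ i)) * (conj (vandI n θ) * vandI n θ) ∂(torusMeasure n) := by
        refine integral_congr_ae (Eventually.of_forall fun θ => ?_)
        simp only
        rw [← Finset.mul_sum, hsum θ, hF]
        ring

/-- Bounded-on-the-torus continuous functions are in every `L^p`. [folklore] -/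
theorem memLp_torus_of_continuous {n : ℕ} {H : (Fin n → ℝ) → ℝ} (hH : Continuous H)
    (p : ENNReal) : MemLp H p (torusMeasure n) := by
  obtain ⟨C, hC⟩ := (isCompact_univ_pi fun _ : Fin n =>
    (isCompact_Icc : IsCompact (Set.Icc (-Real.pi) Real.pi))).exists_bound_of_continuousOn
    hH.continuousOn
  refine MemLp.of_bound hH.aestronglyMeasurable C ?_
  have hae : ∀ᵐ θ ∂(torusMeasure n), θ ∈ Set.univ.pi fun _ : Fin n => Set.Ioc (-Real.pi) Real.pi := by
    rw [torusMeasure_eq_restrict]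
    exact ae_restrict_mem (MeasurableSet.univ_pi fun _ => measurableSet_Ioc)
  filter_upwards [hae] with θ hθ
  exact hC θ fun i _ => Set.Ioc_subset_Icc_self (hθ i (Set.mem_univ _))

/-- The normalising constant `(2π)^n n!` as a positive real. [folklore] -/
theorem heineConst_pos (n : ℕ) : 0 < (2 * Real.pi) ^ n * (n.factorial : ℝ) := by positivity

/-- Cast of the normalising constant to `ℂ`. [folklore] -/
theorem heineConst_cast (n : ℕ) :
    (((2 * Real.pi) ^ n * (n.factorial : ℝ) : ℝ) : ℂ) = (2 * Real.pi : ℂ) ^ n * n.factorial := by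
  push_cast; ring

/-- Heine–Andréief for the modulus symbol: `n!(2π)^n D_n(|f|) = ∫ ∏|f(θ_i)| |Δ|²` (a real
number). [folklore] -/
theorem toeplitzDet_norm_symbol_mul_eq {f : ℝ → ℂ} (hf : Continuous f) (n : ℕ) :
    toeplitzDet (circleCoeff fun θ => (‖f θ‖ : ℂ)) n * ((2 * Real.pi : ℂ) ^ n * n.factorial) =
      ((∫ θ, (∏ i, ‖f (θ i)‖) * ‖vandI n θ‖ ^ 2 ∂(torusMeasure n) : ℝ) : ℂ) := by
  rw [toeplitzDet_mul_eq_integral (by fun_prop) n, ← integral_complex_ofReal]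
  refine integral_congr_ae (Eventually.of_forall fun θ => ?_)
  simp only [conj_mul_eq_ofReal_norm_sq]
  push_cast
  ring

/-- Heine–Andréief for an exponential symbol: `n!(2π)^n D_n(e^g) = ∫ e^{∑ g(θ_i)} |Δ|²`. [folklore] -/
theorem toeplitzDet_exp_symbol_mul_eq {g : ℝ → ℝ} (hg : Continuous g) (n : ℕ) :
    toeplitzDet (circleCoeff fun θ => (Real.exp (g θ) : ℂ)) n *
        ((2 * Real.pi : ℂ) ^ n * n.factorial) =
      ((∫ θ, Real.exp (∑ i, g (θ i)) * ‖vandI n θ‖ ^ 2 ∂(torusMeasure n) : ℝ) : ℂ) := by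
  rw [toeplitzDet_mul_eq_integral (by fun_prop) n, ← integral_complex_ofReal]
  refine integral_congr_ae (Eventually.of_forall fun θ => ?_)
  simp only [conj_mul_eq_ofReal_norm_sq, Real.exp_sum]
  push_cast
  ring

/-- **The modulus bound** `|D_n(f)| ≤ D_n(|f|)`. [folklore] -/
theorem norm_toeplitzDet_le {f : ℝ → ℂ} (hf : Continuous f) (n : ℕ) :
    ‖toeplitzDet (circleCoeff f) n‖ ≤ (toeplitzDet (circleCoeff fun θ => (‖f θ‖ : ℂ)) n).re := by
  have hK := heineConst_pos n
  have h1 := toeplitzDet_mul_eq_integral hf n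
  have h2 := toeplitzDet_norm_symbol_mul_eq hf n
  rw [← heineConst_cast] at h1 h2
  have h2' : (toeplitzDet (circleCoeff fun θ => (‖f θ‖ : ℂ)) n).re *
      ((2 * Real.pi) ^ n * (n.factorial : ℝ)) =
      ∫ θ, (∏ i, ‖f (θ i)‖) * ‖vandI n θ‖ ^ 2 ∂(torusMeasure n) := by
    have := congrArg Complex.re h2
    rwa [Complex.re_mul_ofReal, Complex.ofReal_re] at this
  have h1' : ‖toeplitzDet (circleCoeff f) n‖ * ((2 * Real.pi) ^ n * (n.factorial : ℝ)) ≤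
      ∫ θ, (∏ i, ‖f (θ i)‖) * ‖vandI n θ‖ ^ 2 ∂(torusMeasure n) := by
    have := congrArg (fun z : ℂ => ‖z‖) h1
    simp only [norm_mul, Complex.norm_real, Real.norm_of_nonneg hK.le] at this
    rw [this]
    refine (MeasureTheory.norm_integral_le_integral_norm _).trans (le_of_eq ?_)
    refine integral_congr_ae (Eventually.of_forall fun θ => ?_)
    simp only [norm_mul, norm_prod, conj_mul_eq_ofReal_norm_sq, Complex.norm_real,
      Real.norm_of_nonneg (sq_nonneg _)]
  exact le_of_mul_le_mul_right (h1'.trans h2'.symm.le) hK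

/-- **Hölder's inequality on the torus** for the Heine integrals of exponential symbols. [folklore] -/
theorem integral_exp_sum_mul_le_rpow {g₁ g₂ : ℝ → ℝ} (hg₁ : Continuous g₁) (hg₂ : Continuous g₂)
    (n : ℕ) {a b : ℝ} (ha : 0 < a) (hb : 0 < b) (hab : a + b = 1) :
    (∫ θ, Real.exp (∑ i, (a * g₁ (θ i) + b * g₂ (θ i))) * ‖vandI n θ‖ ^ 2 ∂(torusMeasure n)) ≤
      (∫ θ, Real.exp (∑ i, g₁ (θ i)) * ‖vandI n θ‖ ^ 2 ∂(torusMeasure n)) ^ a *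
        (∫ θ, Real.exp (∑ i, g₂ (θ i)) * ‖vandI n θ‖ ^ 2 ∂(torusMeasure n)) ^ b := by
  set Φ : (Fin n → ℝ) → ℝ := fun θ => ‖vandI n θ‖ ^ 2 with hΦ
  have hΦ0 : ∀ θ, 0 ≤ Φ θ := fun θ => sq_nonneg _
  have hΦc : Continuous Φ := (continuous_norm.comp (continuous_vandI n)).pow 2
  set F : (Fin n → ℝ) → ℝ := fun θ => Real.exp (a * ∑ i, g₁ (θ i)) * Φ θ ^ a with hF
  set G : (Fin n → ℝ) → ℝ := fun θ => Real.exp (b * ∑ i, g₂ (θ i)) * Φ θ ^ b with hG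
  have hS₁ : Continuous fun θ : Fin n → ℝ => ∑ i, g₁ (θ i) :=
    continuous_finsetSum _ fun i _ => hg₁.comp (continuous_apply i)
  have hS₂ : Continuous fun θ : Fin n → ℝ => ∑ i, g₂ (θ i) :=
    continuous_finsetSum _ fun i _ => hg₂.comp (continuous_apply i)
  have hFc : Continuous F := by
    refine ((hS₁.const_mul a).rexp).mul (hΦc.rpow_const fun θ => Or.inr ha.le)
  have hGc : Continuous G := by
    refine ((hS₂.const_mul b).rexp).mul (hΦc.rpow_const fun θ => Or.inr hb.le)
  have hFG : ∀ θ, Real.exp (∑ i, (a * g₁ (θ i) + b * g₂ (θ i))) * ‖vandI n θ‖ ^ 2 = F θ * G θ := by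
    intro θ
    have hΦab : Φ θ ^ a * Φ θ ^ b = Φ θ := by
      rw [← Real.rpow_add' (hΦ0 θ) (by rw [hab]; norm_num), hab, Real.rpow_one]
    calc Real.exp (∑ i, (a * g₁ (θ i) + b * g₂ (θ i))) * ‖vandI n θ‖ ^ 2
        = Real.exp (a * ∑ i, g₁ (θ i)) * Real.exp (b * ∑ i, g₂ (θ i)) * (Φ θ ^ a * Φ θ ^ b) := by
          rw [hΦab, Finset.sum_add_distrib, ← Finset.mul_sum, ← Finset.mul_sum, Real.exp_add]
      _ = F θ * G θ := by rw [hF, hG]; ring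
  have hFp : ∀ θ, F θ ^ (1 / a) = Real.exp (∑ i, g₁ (θ i)) * Φ θ := by
    intro θ
    rw [hF]
    simp only
    rw [Real.mul_rpow (Real.exp_pos _).le (Real.rpow_nonneg (hΦ0 θ) _), ← Real.exp_mul,
      ← Real.rpow_mul (hΦ0 θ)]
    rw [show a * (∑ i, g₁ (θ i)) * (1 / a) = ∑ i, g₁ (θ i) by field_simp,
      show a * (1 / a) = 1 by field_simp, Real.rpow_one]
  have hGq : ∀ θ, G θ ^ (1 / b) = Real.exp (∑ i, g₂ (θ i)) * Φ θ := by
    intro θ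
    rw [hG]
    simp only
    rw [Real.mul_rpow (Real.exp_pos _).le (Real.rpow_nonneg (hΦ0 θ) _), ← Real.exp_mul,
      ← Real.rpow_mul (hΦ0 θ)]
    rw [show b * (∑ i, g₂ (θ i)) * (1 / b) = ∑ i, g₂ (θ i) by field_simp,
      show b * (1 / b) = 1 by field_simp, Real.rpow_one]
  have hH := integral_mul_le_Lp_mul_Lq_of_nonneg (μ := torusMeasure n)
    (Real.holderConjugate_one_div ha hb hab)
    (Eventually.of_forall fun θ => (mul_nonneg (Real.exp_pos _).le (Real.rpow_nonneg (hΦ0 θ) _) :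
      (0 : ℝ) ≤ F θ))
    (Eventually.of_forall fun θ => (mul_nonneg (Real.exp_pos _).le (Real.rpow_nonneg (hΦ0 θ) _) :
      (0 : ℝ) ≤ G θ))
    (memLp_torus_of_continuous hFc _) (memLp_torus_of_continuous hGc _)
  have hFint : (∫ θ, F θ ^ (1 / a) ∂(torusMeasure n)) =
      ∫ θ, Real.exp (∑ i, g₁ (θ i)) * Φ θ ∂(torusMeasure n) :=
    integral_congr_ae (Eventually.of_forall hFp)
  have hGint : (∫ θ, G θ ^ (1 / b) ∂(torusMeasure n)) =
      ∫ θ, Real.exp (∑ i, g₂ (θ i)) * Φ θ ∂(torusMeasure n) :=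
    integral_congr_ae (Eventually.of_forall hGq)
  rw [hFint, hGint, one_div_one_div, one_div_one_div] at hH
  calc (∫ θ, Real.exp (∑ i, (a * g₁ (θ i) + b * g₂ (θ i))) * ‖vandI n θ‖ ^ 2 ∂(torusMeasure n))
      = ∫ θ, F θ * G θ ∂(torusMeasure n) := integral_congr_ae (Eventually.of_forall hFG)
    _ ≤ _ := hH

/-- **Log-convexity of `g ↦ D_n(e^g)`** on real continuous symbols (Hölder in the
Heine–Andréief integral). [folklore] -/
theorem log_toeplitzDet_exp_convex {g₁ g₂ : ℝ → ℝ} (hg₁ : Continuous g₁) (hg₂ : Continuous g₂)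
    (n : ℕ) {a b : ℝ} (ha : 0 ≤ a) (hb : 0 ≤ b) (hab : a + b = 1) :
    Real.log (toeplitzDet (circleCoeff fun θ =>
        (Real.exp (a * g₁ θ + b * g₂ θ) : ℂ)) n).re ≤
      a * Real.log (toeplitzDet (circleCoeff fun θ => (Real.exp (g₁ θ) : ℂ)) n).re +
        b * Real.log (toeplitzDet (circleCoeff fun θ => (Real.exp (g₂ θ) : ℂ)) n).re := by
  rcases ha.eq_or_lt with rfl | ha'
  · simp only [zero_add] at hab
    subst hab
    simp
  rcases hb.eq_or_lt with rfl | hb'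
  · simp only [add_zero] at hab
    subst hab
    simp
  set K : ℝ := (2 * Real.pi) ^ n * (n.factorial : ℝ) with hKdef
  have hK := heineConst_pos n
  -- the three Heine integrals
  have hJ : ∀ {g : ℝ → ℝ}, Continuous g →
      (toeplitzDet (circleCoeff fun θ => (Real.exp (g θ) : ℂ)) n).re * K =
        ∫ θ, Real.exp (∑ i, g (θ i)) * ‖vandI n θ‖ ^ 2 ∂(torusMeasure n) := by
    intro g hg
    have := congrArg Complex.re (toeplitzDet_exp_symbol_mul_eq hg n)
    rwa [← heineConst_cast, Complex.re_mul_ofReal, Complex.ofReal_re] at this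
  have hDpos : ∀ {g : ℝ → ℝ}, Continuous g →
      0 < (toeplitzDet (circleCoeff fun θ => (Real.exp (g θ) : ℂ)) n).re := fun hg =>
    (toeplitzDet_pos (w := fun θ => Real.exp (_)) (by fun_prop) (fun θ => Real.exp_pos _) n).1
  have hg₁₂ : Continuous fun θ => a * g₁ θ + b * g₂ θ := by fun_prop
  have h0 := hJ hg₁₂
  have h1 := hJ hg₁
  have h2 := hJ hg₂
  have hH := integral_exp_sum_mul_le_rpow hg₁ hg₂ n ha' hb' hab
  rw [← h0, ← h1, ← h2] at hH
  have hD0 := hDpos hg₁₂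
  have hD1 := hDpos hg₁
  have hD2 := hDpos hg₂
  -- take logarithms
  have hlog := Real.log_le_log (mul_pos hD0 hK) hH
  rw [Real.log_mul hD0.ne' hK.ne', Real.log_mul (Real.rpow_pos_of_pos (mul_pos hD1 hK) _).ne'
    (Real.rpow_pos_of_pos (mul_pos hD2 hK) _).ne', Real.log_rpow (mul_pos hD1 hK),
    Real.log_rpow (mul_pos hD2 hK), Real.log_mul hD1.ne' hK.ne', Real.log_mul hD2.ne' hK.ne'] at hlog
  have : Real.log K = a * Real.log K + b * Real.log K := by rw [← add_mul, hab, one_mul]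
  linarith

end Andreief

/-! ### Elementary symbol calculus: linearity, translation, continuity -/

section SymbolCalculus

/-- `circleCoeff (f + g) = circleCoeff f + circleCoeff g` for continuous `f, g`. [folklore] -/
theorem circleCoeff_add {f g : ℝ → ℂ} (hf : Continuous f) (hg : Continuous g) (j : ℤ) :
    circleCoeff (fun θ => f θ + g θ) j = circleCoeff f j + circleCoeff g j := by
  have h := circleCoeff_sub (f := fun θ => f θ + g θ) (g := g) (by fun_prop) hg j
  simp only [add_sub_cancel_right] at h
  calc circleCoeff (fun θ => f θ + g θ) j = circleCoeff (fun θ => f θ) j + circleCoeff g j := by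
        rw [h]; ring
    _ = circleCoeff f j + circleCoeff g j := rfl

/-- **Translation rule**: `(f(· - s))_k = e^{-iks} f_k` for a `2π`-periodic `f`. [folklore] -/
theorem circleCoeff_comp_sub {f : ℝ → ℂ} (hper : Function.Periodic f (2 * Real.pi)) (s : ℝ)
    (k : ℤ) :
    circleCoeff (fun θ => f (θ - s)) k = Complex.exp (-(k * s * I)) * circleCoeff f k := by
  rw [circleCoeff, circleCoeff, mul_left_comm]
  congr 1
  rw [← intervalIntegral.integral_const_mul]
  -- substitute `θ = x + s`
  have hsub := intervalIntegral.integral_comp_add_right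
    (fun θ : ℝ => Complex.exp (-(k * θ * I)) * f (θ - s)) s (a := -Real.pi - s) (b := Real.pi - s)
  simp only [add_sub_cancel_right, sub_add_cancel] at hsub
  rw [← hsub]
  -- the integrand `x ↦ e^{-ik(x+s)} f(x)` is `2π`-periodic: shift the window back
  have hperI : Function.Periodic (fun x : ℝ => Complex.exp (-(k * ((x + s : ℝ) : ℂ) * I)) * f x)
      (2 * Real.pi) := by
    intro x
    simp only
    rw [hper x]
    congr 1
    rw [show -((k : ℂ) * (((x + 2 * Real.pi + s : ℝ)) : ℂ) * I) =
        -((k : ℂ) * ((x + s : ℝ) : ℂ) * I) + (-k : ℤ) * (2 * Real.pi * I) by push_cast; ring,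
      Complex.exp_add, Complex.exp_int_mul_two_pi_mul_I, mul_one]
  have hwin := hperI.intervalIntegral_add_eq (-Real.pi - s) (-Real.pi)
  rw [show -Real.pi - s + 2 * Real.pi = Real.pi - s by ring,
    show -Real.pi + 2 * Real.pi = Real.pi by ring] at hwin
  push_cast at hwin ⊢
  rw [hwin]
  refine intervalIntegral.integral_congr fun x _ => ?_
  rw [← mul_assoc, ← Complex.exp_add]
  congr 2
  ring

/-- **Phase invariance of Toeplitz determinants**: `det (e^{-i(j-k)s} c_{j-k}) = det (c_{j-k})`
(conjugation by the diagonal unitary `diag(e^{-ijs})`). [folklore] -/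
theorem toeplitzDet_phase (c : ℤ → ℂ) (s : ℝ) (n : ℕ) :
    toeplitzDet (fun k : ℤ => Complex.exp (-(k * s * I)) * c k) n = toeplitzDet c n := by
  set u : Fin n → ℂ := fun j => Complex.exp (-(((j : ℕ) : ℂ) * s * I)) with hu
  set v : Fin n → ℂ := fun j => Complex.exp (((j : ℕ) : ℂ) * s * I) with hv
  have hM : toeplitzMatrix (fun k : ℤ => Complex.exp (-(k * s * I)) * c k) n =
      Matrix.of fun j k => u j * ((Matrix.of fun j' k' => v k' * toeplitzMatrix c n j' k') j k) := by
    ext j k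
    simp only [toeplitzMatrix_apply, Matrix.of_apply, hu, hv]
    rw [← mul_assoc, ← Complex.exp_add]
    congr 2
    push_cast
    ring
  rw [toeplitzDet, toeplitzDet, hM, det_mul_column, det_mul_row, ← mul_assoc,
    ← Finset.prod_mul_distrib]
  have : ∀ j : Fin n, u j * v j = 1 := fun j => by
    rw [hu, hv]; simp only; rw [← Complex.exp_add, neg_add_cancel, Complex.exp_zero]
  simp [this]

/-- **Translation invariance**: `D_n(f(· - s)) = D_n(f)` for `2π`-periodic `f`. [folklore] -/
theorem toeplitzDet_comp_sub {f : ℝ → ℂ} (hper : Function.Periodic f (2 * Real.pi)) (s : ℝ)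
    (n : ℕ) : toeplitzDet (circleCoeff fun θ => f (θ - s)) n = toeplitzDet (circleCoeff f) n := by
  have : circleCoeff (fun θ => f (θ - s)) = fun k : ℤ => Complex.exp (-(k * s * I)) * circleCoeff f k :=
    funext fun k => circleCoeff_comp_sub hper s k
  rw [this, toeplitzDet_phase]

/-- A continuous periodic function is bounded. [folklore] -/
theorem exists_norm_le_of_periodic {β : Type*} [SeminormedAddCommGroup β] {h : ℝ → β}
    (hc : Continuous h) (hp : Function.Periodic h (2 * Real.pi)) : ∃ B, ∀ x, ‖h x‖ ≤ B := by
  obtain ⟨B, hB⟩ := (hp.isBounded_of_continuous Real.two_pi_pos.ne' hc).exists_norm_le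
  exact ⟨B, fun x => hB _ (Set.mem_range_self x)⟩

/-- A continuous periodic function is uniformly continuous (ε–δ form). [folklore] -/
theorem exists_forall_dist_lt_of_periodic {β : Type*} [PseudoMetricSpace β] {h : ℝ → β}
    (hc : Continuous h) (hp : Function.Periodic h (2 * Real.pi)) {ε : ℝ} (hε : 0 < ε) :
    ∃ δ > 0, ∀ x y : ℝ, |x - y| < δ → dist (h x) (h y) < ε := by
  have hK : IsCompact (Set.Icc (-(2 * Real.pi)) (2 * Real.pi)) := isCompact_Icc
  obtain ⟨δ₀, hδ₀, hU⟩ := Metric.uniformContinuousOn_iff.1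
    (hK.uniformContinuousOn_of_continuous hc.continuousOn) ε hε
  refine ⟨min δ₀ Real.pi, lt_min hδ₀ Real.pi_pos, fun x y hxy => ?_⟩
  have h2π := Real.two_pi_pos
  set m : ℤ := toIcoDiv h2π (-Real.pi) x with hm
  have hx' : x - m • (2 * Real.pi) ∈ Set.Ico (-Real.pi) (-Real.pi + 2 * Real.pi) :=
    sub_toIcoDiv_zsmul_mem_Ico h2π (-Real.pi) x
  rw [Set.mem_Ico] at hx'
  have hxK : x - m • (2 * Real.pi) ∈ Set.Icc (-(2 * Real.pi)) (2 * Real.pi) := by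
    constructor <;> linarith [hx'.1, hx'.2, Real.pi_pos]
  have hxy' : |x - y| < Real.pi := lt_of_lt_of_le hxy (min_le_right _ _)
  have hyK : y - m • (2 * Real.pi) ∈ Set.Icc (-(2 * Real.pi)) (2 * Real.pi) := by
    rw [abs_lt] at hxy'
    constructor <;> linarith [hx'.1, hx'.2, Real.pi_pos]
  have hd : dist (x - m • (2 * Real.pi)) (y - m • (2 * Real.pi)) < δ₀ := by
    rw [Real.dist_eq, show x - m • (2 * Real.pi) - (y - m • (2 * Real.pi)) = x - y by ring]
    exact lt_of_lt_of_le hxy (min_le_left _ _)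
  have := hU _ hxK _ hyK hd
  rwa [hp.sub_zsmul_eq, hp.sub_zsmul_eq] at this

/-- Coefficients converge under uniform convergence of continuous symbols. [folklore] -/
theorem tendsto_circleCoeff_of_tendstoUniformly {ι : Type*} {l : Filter ι} {F : ι → ℝ → ℂ}
    {f : ℝ → ℂ} (hF : ∀ i, Continuous (F i)) (hf : Continuous f) (h : TendstoUniformly F f l)
    (k : ℤ) : Tendsto (fun i => circleCoeff (F i) k) l (𝓝 (circleCoeff f k)) := by
  rw [Metric.tendsto_nhds]
  intro ε hε
  have h' := Metric.tendstoUniformly_iff.1 h (ε / 2) (half_pos hε)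
  filter_upwards [h'] with i hi
  rw [dist_eq_norm, ← circleCoeff_sub (hF i) hf]
  refine lt_of_le_of_lt (norm_circleCoeff_le (B := ε / 2) (fun θ => ?_) k) (half_lt_self hε)
  rw [← dist_eq_norm, dist_comm]
  exact (hi θ).le

/-- Toeplitz determinants depend continuously on finitely many coefficients. [folklore] -/
theorem tendsto_toeplitzDet_of_tendsto {ι : Type*} {l : Filter ι} {C : ι → ℤ → ℂ} {c : ℤ → ℂ}
    (h : ∀ k, Tendsto (fun i => C i k) l (𝓝 (c k))) (n : ℕ) :
    Tendsto (fun i => toeplitzDet (C i) n) l (𝓝 (toeplitzDet c n)) := by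
  have hT : Tendsto (fun i => toeplitzMatrix (C i) n) l (𝓝 (toeplitzMatrix c n)) := by
    refine tendsto_pi_nhds.2 fun j => tendsto_pi_nhds.2 fun k => ?_
    simp only [toeplitzMatrix_apply]
    exact h _
  exact ((continuous_id.matrix_det).tendsto _).comp hT

/-- Uniform convergence of real symbols gives uniform convergence of the exponentials. [folklore] -/
theorem tendstoUniformly_cexp_of_real {ι : Type*} {l : Filter ι} {G : ι → ℝ → ℝ} {g : ℝ → ℝ}
    (hB : ∃ B, ∀ x, |g x| ≤ B) (h : TendstoUniformly G g l) :
    TendstoUniformly (fun i θ => (Real.exp (G i θ) : ℂ)) (fun θ => (Real.exp (g θ) : ℂ)) l := by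
  obtain ⟨B, hB⟩ := hB
  rw [Metric.tendstoUniformly_iff]
  intro ε hε
  -- choose `η ≤ 1` with `2 η e^B < ε`
  obtain ⟨η, hη0, hη1, hηε⟩ : ∃ η : ℝ, 0 < η ∧ η ≤ 1 ∧ 2 * η * Real.exp B < ε := by
    refine ⟨min 1 (ε / (4 * Real.exp B)), lt_min one_pos (by positivity), min_le_left _ _, ?_⟩
    have hE := Real.exp_pos B
    calc 2 * min 1 (ε / (4 * Real.exp B)) * Real.exp B
        ≤ 2 * (ε / (4 * Real.exp B)) * Real.exp B := by gcongr; exact min_le_right _ _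
      _ = ε / 2 := by field_simp; ring
      _ < ε := half_lt_self hε
  filter_upwards [Metric.tendstoUniformly_iff.1 h η hη0] with i hi θ
  have hd := hi θ
  rw [Real.dist_eq] at hd
  rw [dist_eq_norm, ← Complex.ofReal_sub, Complex.norm_real, Real.norm_eq_abs,
    show Real.exp (g θ) - Real.exp (G i θ) = -(Real.exp (g θ) * (Real.exp (G i θ - g θ) - 1)) by
      rw [Real.exp_sub]; field_simp; ring, abs_neg, abs_mul, Real.abs_exp]
  have h1 : |Real.exp (G i θ - g θ) - 1| ≤ 2 * |G i θ - g θ| :=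
    Real.abs_exp_sub_one_le (by rw [abs_sub_comm]; exact hd.le.trans hη1)
  have h2 : Real.exp (g θ) ≤ Real.exp B := Real.exp_le_exp.2 ((le_abs_self _).trans (hB θ))
  calc Real.exp (g θ) * |Real.exp (G i θ - g θ) - 1|
      ≤ Real.exp B * (2 * |G i θ - g θ|) := by gcongr
    _ ≤ Real.exp B * (2 * η) := by gcongr; rw [abs_sub_comm]; exact hd.le
    _ = 2 * η * Real.exp B := by ring
    _ < ε := hηε

end SymbolCalculus

/-! ### Fejér means -/

section Fejer

/-- The Dirichlet-type sum `∑_{j=0}^{N} e^{ijs}`. [folklore] -/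
def dirichletSum (N : ℕ) (s : ℝ) : ℂ := ∑ j ∈ Finset.range (N + 1), Complex.exp ((j : ℂ) * s * I)

/-- The **Fejér kernel** `K_N(s) = |∑_{j=0}^{N} e^{ijs}|² / (N + 1) ≥ 0`. [folklore] -/
def fejerKernel (N : ℕ) (s : ℝ) : ℝ := ‖dirichletSum N s‖ ^ 2 / (N + 1)

/-- The Dirichlet-type sum is continuous. [folklore] -/
theorem continuous_dirichletSum (N : ℕ) : Continuous (dirichletSum N) := by
  unfold dirichletSum; fun_prop

/-- The Fejér kernel is continuous. [folklore] -/
theorem continuous_fejerKernel (N : ℕ) : Continuous (fejerKernel N) := by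
  unfold fejerKernel
  exact ((continuous_norm.comp (continuous_dirichletSum N)).pow 2).div_const _

/-- **Positivity of the Fejér kernel**. [folklore] -/
theorem fejerKernel_nonneg (N : ℕ) (s : ℝ) : 0 ≤ fejerKernel N s := by
  unfold fejerKernel; positivity

/-- The Dirichlet-type sum is `2π`-periodic. [folklore] -/
theorem dirichletSum_periodic (N : ℕ) : Function.Periodic (dirichletSum N) (2 * Real.pi) := by
  intro s
  unfold dirichletSum
  refine Finset.sum_congr rfl fun j _ => ?_
  rw [show (j : ℂ) * ((s + 2 * Real.pi : ℝ) : ℂ) * I = (j : ℂ) * s * I + (j : ℤ) * (2 * Real.pi * I) by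
    push_cast; ring, Complex.exp_add, Complex.exp_int_mul_two_pi_mul_I, mul_one]

/-- The Fejér kernel is `2π`-periodic. [folklore] -/
theorem fejerKernel_periodic (N : ℕ) : Function.Periodic (fejerKernel N) (2 * Real.pi) := by
  intro s; unfold fejerKernel; rw [dirichletSum_periodic]

/-- Expansion `K_N(s) = (N+1)⁻¹ ∑_{j,l ≤ N} e^{i(j-l)s}` (as a complex number). [folklore] -/
theorem fejerKernel_eq_sum (N : ℕ) (s : ℝ) :
    (fejerKernel N s : ℂ) = ((N : ℂ) + 1)⁻¹ * ∑ j ∈ Finset.range (N + 1),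
      ∑ l ∈ Finset.range (N + 1), Complex.exp ((((j : ℤ) - (l : ℤ) : ℤ) : ℂ) * s * I) := by
  unfold fejerKernel
  push_cast
  rw [div_eq_inv_mul]
  congr 1
  rw [show ((‖dirichletSum N s‖ : ℂ)) ^ 2 = conj (dirichletSum N s) * dirichletSum N s by
    rw [conj_mul_eq_ofReal_norm_sq]; push_cast; ring]
  unfold dirichletSum
  rw [map_sum, Finset.sum_mul_sum, Finset.sum_comm]
  refine Finset.sum_congr rfl fun j _ => Finset.sum_congr rfl fun l _ => ?_
  rw [show Complex.exp ((l : ℂ) * s * I) = expI l s from rfl, conj_expI, ← Complex.exp_add]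
  congr 1
  ring

/-- **Unit mass**: the zeroth Fourier coefficient of `K_N` is `1`. [folklore] -/
theorem circleCoeff_fejerKernel_zero (N : ℕ) :
    circleCoeff (fun s => (fejerKernel N s : ℂ)) 0 = 1 := by
  simp_rw [fejerKernel_eq_sum]
  rw [circleCoeff_const_mul, circleCoeff_finset_sum _ _ (fun j _ => by fun_prop)]
  have h : ∀ j ∈ Finset.range (N + 1), circleCoeff (fun s => ∑ l ∈ Finset.range (N + 1),
      Complex.exp ((((j : ℤ) - (l : ℤ) : ℤ) : ℂ) * s * I)) 0 = 1 := by
    intro j hj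
    rw [circleCoeff_finset_sum _ _ (fun l _ => by fun_prop)]
    simp_rw [circleCoeff_cexp_int_mul]
    rw [Finset.sum_eq_single j]
    · simp
    · intro l _ hl
      rw [if_neg]
      intro h; apply hl; omega
    · intro h; exact absurd hj h
  rw [Finset.sum_congr rfl h, Finset.sum_const, Finset.card_range]
  simp only [nsmul_eq_mul, mul_one]
  push_cast
  exact inv_mul_cancel₀ (Nat.cast_add_one_ne_zero N)

/-- `(2π)⁻¹ ∫_{-π}^{π} K_N = 1`. [folklore] -/
theorem integral_fejerKernel (N : ℕ) :
    (2 * Real.pi)⁻¹ * ∫ s in (-Real.pi)..Real.pi, fejerKernel N s = 1 := by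
  have h := circleCoeff_fejerKernel_zero N
  rw [circleCoeff] at h
  simp only [Int.cast_zero, zero_mul, neg_zero, Complex.exp_zero, one_mul,
    intervalIntegral.integral_ofReal] at h
  exact_mod_cast h

/-- The **Fejér mean** `σ_N h(θ) = (2π)⁻¹ ∫_{-π}^{π} K_N(θ - s) h(s) ds` of a real symbol. [folklore] -/
def fejerMean (N : ℕ) (h : ℝ → ℝ) (θ : ℝ) : ℝ :=
  (2 * Real.pi)⁻¹ * ∫ s in (-Real.pi)..Real.pi, fejerKernel N (θ - s) * h s

/-- The pair count `#{(j,l) ∈ [0,N]² : j - l = k}` (numerator of the Fejér weight). [folklore] -/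
def fejerCount (N : ℕ) (k : ℤ) : ℕ :=
  ∑ j ∈ Finset.range (N + 1), ∑ l ∈ Finset.range (N + 1), if k = (j : ℤ) - (l : ℤ) then 1 else 0

/-- The pair count is at most `N + 1` (so the Fejér weight is `≤ 1`). [folklore] -/
theorem fejerCount_le (N : ℕ) (k : ℤ) : fejerCount N k ≤ N + 1 := by
  unfold fejerCount
  have h : ∀ j ∈ Finset.range (N + 1),
      (∑ l ∈ Finset.range (N + 1), if k = (j : ℤ) - (l : ℤ) then 1 else 0) ≤ 1 := by
    intro j _
    rw [Finset.sum_boole, Nat.cast_id, Finset.card_le_one]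
    intro a ha b hb
    simp only [Finset.mem_filter] at ha hb
    omega
  calc (∑ j ∈ Finset.range (N + 1), ∑ l ∈ Finset.range (N + 1),
      if k = (j : ℤ) - (l : ℤ) then 1 else 0)
      ≤ ∑ _j ∈ Finset.range (N + 1), 1 := Finset.sum_le_sum h
    _ = N + 1 := by simp

/-- The pair count vanishes for `|k| > N`. [folklore] -/
theorem fejerCount_eq_zero (N : ℕ) {k : ℤ} (hk : (N : ℤ) < |k|) : fejerCount N k = 0 := by
  unfold fejerCount
  refine Finset.sum_eq_zero fun j hj => Finset.sum_eq_zero fun l hl => ?_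
  rw [Finset.mem_range] at hj hl
  rw [if_neg]
  rw [lt_abs] at hk
  omega

/-- **The Fejér mean is a trigonometric polynomial**:
`σ_N h(θ) = (N+1)⁻¹ ∑_{j,l ≤ N} h_{j-l} e^{i(j-l)θ}`. [folklore] -/
theorem fejerMean_eq_sum {h : ℝ → ℝ} (hc : Continuous h) (N : ℕ) (θ : ℝ) :
    (fejerMean N h θ : ℂ) = ((N : ℂ) + 1)⁻¹ * ∑ j ∈ Finset.range (N + 1),
      ∑ l ∈ Finset.range (N + 1), circleCoeff (fun s => (h s : ℂ)) ((j : ℤ) - (l : ℤ)) *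
        Complex.exp ((((j : ℤ) - (l : ℤ) : ℤ) : ℂ) * θ * I) := by
  unfold fejerMean
  push_cast
  rw [← intervalIntegral.integral_ofReal]
  push_cast
  simp_rw [fejerKernel_eq_sum]
  -- rewrite the integrand as a double finite sum
  have hI : ∀ s : ℝ, ((N : ℂ) + 1)⁻¹ * (∑ j ∈ Finset.range (N + 1), ∑ l ∈ Finset.range (N + 1),
      Complex.exp ((((j : ℤ) - (l : ℤ) : ℤ) : ℂ) * ((θ - s : ℝ) : ℂ) * I)) * (h s : ℂ) =
      ∑ j ∈ Finset.range (N + 1), ∑ l ∈ Finset.range (N + 1),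
        ((N : ℂ) + 1)⁻¹ * Complex.exp ((((j : ℤ) - (l : ℤ) : ℤ) : ℂ) * θ * I) *
          (Complex.exp (-((((j : ℤ) - (l : ℤ) : ℤ) : ℂ) * s * I)) * (h s : ℂ)) := by
    intro s
    rw [Finset.mul_sum, Finset.sum_mul]
    refine Finset.sum_congr rfl fun j _ => ?_
    rw [Finset.mul_sum, Finset.sum_mul]
    refine Finset.sum_congr rfl fun l _ => ?_
    rw [show (((j : ℤ) - (l : ℤ) : ℤ) : ℂ) * ((θ - s : ℝ) : ℂ) * I =
      (((j : ℤ) - (l : ℤ) : ℤ) : ℂ) * θ * I + -((((j : ℤ) - (l : ℤ) : ℤ) : ℂ) * s * I) by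
      push_cast; ring, Complex.exp_add]
    ring
  simp_rw [hI]
  have hint : ∀ j l : ℕ, IntervalIntegrable (fun s : ℝ =>
      ((N : ℂ) + 1)⁻¹ * Complex.exp ((((j : ℤ) - (l : ℤ) : ℤ) : ℂ) * θ * I) *
        (Complex.exp (-((((j : ℤ) - (l : ℤ) : ℤ) : ℂ) * s * I)) * (h s : ℂ))) volume
        (-Real.pi) Real.pi :=
    fun j l => Continuous.intervalIntegrable (by fun_prop) _ _
  rw [intervalIntegral.integral_finsetSum (fun j _ =>
    (Continuous.intervalIntegrable (by fun_prop) _ _ : IntervalIntegrable _ volume _ _))]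
  rw [Finset.mul_sum, Finset.mul_sum]
  refine Finset.sum_congr rfl fun j _ => ?_
  rw [intervalIntegral.integral_finsetSum (fun l _ => hint j l), Finset.mul_sum, Finset.mul_sum]
  refine Finset.sum_congr rfl fun l _ => ?_
  rw [intervalIntegral.integral_const_mul, circleCoeff]
  push_cast
  ring

/-- **The Fourier coefficients of the Fejér mean**: `(σ_N h)_k = w_{N,k} h_k` with the weight
`w_{N,k} = #{(j,l) ∈ [0,N]² : j - l = k}/(N+1) ∈ [0, 1]`. [folklore] -/
theorem circleCoeff_fejerMean {h : ℝ → ℝ} (hc : Continuous h) (N : ℕ) (k : ℤ) :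
    circleCoeff (fun θ => (fejerMean N h θ : ℂ)) k =
      circleCoeff (fun s => (h s : ℂ)) k * ((fejerCount N k : ℂ) / ((N : ℂ) + 1)) := by
  have hfun : (fun θ => (fejerMean N h θ : ℂ)) = fun θ : ℝ => ((N : ℂ) + 1)⁻¹ *
      ∑ j ∈ Finset.range (N + 1), ∑ l ∈ Finset.range (N + 1),
        circleCoeff (fun s => (h s : ℂ)) ((j : ℤ) - (l : ℤ)) *
          Complex.exp ((((j : ℤ) - (l : ℤ) : ℤ) : ℂ) * θ * I) := funext (fejerMean_eq_sum hc N)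
  rw [hfun, circleCoeff_const_mul, circleCoeff_finset_sum _ _ (fun j _ => by fun_prop)]
  have hj : ∀ j : ℕ, circleCoeff (fun θ => ∑ l ∈ Finset.range (N + 1),
      circleCoeff (fun s => (h s : ℂ)) ((j : ℤ) - (l : ℤ)) *
        Complex.exp ((((j : ℤ) - (l : ℤ) : ℤ) : ℂ) * θ * I)) k =
      ∑ l ∈ Finset.range (N + 1),
        circleCoeff (fun s => (h s : ℂ)) k * (if k = (j : ℤ) - (l : ℤ) then 1 else 0) := by
    intro j
    rw [circleCoeff_finset_sum _ _ (fun l _ => by fun_prop)]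
    refine Finset.sum_congr rfl fun l _ => ?_
    rw [circleCoeff_const_mul, circleCoeff_cexp_int_mul]
    split_ifs with hkl
    · rw [← hkl]
    · simp
  simp_rw [hj, ← Finset.mul_sum]
  rw [fejerCount]
  push_cast
  ring

/-- `|(σ_N h)_k| ≤ |h_k|`. [folklore] -/
theorem norm_circleCoeff_fejerMean_le {h : ℝ → ℝ} (hc : Continuous h) (N : ℕ) (k : ℤ) :
    ‖circleCoeff (fun θ => (fejerMean N h θ : ℂ)) k‖ ≤ ‖circleCoeff (fun s => (h s : ℂ)) k‖ := by
  rw [circleCoeff_fejerMean hc, norm_mul]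
  refine mul_le_of_le_one_right (norm_nonneg _) ?_
  rw [norm_div, Complex.norm_natCast, show ‖(N : ℂ) + 1‖ = (N : ℝ) + 1 by
    exact_mod_cast Complex.norm_natCast (N + 1), div_le_one (by positivity)]
  exact_mod_cast fejerCount_le N k

/-- `(σ_N h)_k = 0` for `|k| > N`: the Fejér mean is a trigonometric polynomial of degree `≤ N`. [folklore] -/
theorem circleCoeff_fejerMean_eq_zero {h : ℝ → ℝ} (hc : Continuous h) (N : ℕ) {k : ℤ}
    (hk : (N : ℤ) < |k|) : circleCoeff (fun θ => (fejerMean N h θ : ℂ)) k = 0 := by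
  rw [circleCoeff_fejerMean hc, fejerCount_eq_zero N hk]
  simp

/-- The Fejér mean is continuous. [folklore] -/
theorem continuous_fejerMean {h : ℝ → ℝ} (hc : Continuous h) (N : ℕ) :
    Continuous (fejerMean N h) := by
  have : fejerMean N h = fun θ => ((fejerMean N h θ : ℂ)).re := by funext θ; simp
  rw [this]
  simp_rw [fejerMean_eq_sum hc]
  fun_prop

/-- The Fejér mean is `2π`-periodic. [folklore] -/
theorem fejerMean_periodic {h : ℝ → ℝ} (hc : Continuous h) (N : ℕ) :
    Function.Periodic (fejerMean N h) (2 * Real.pi) := by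
  intro θ
  apply Complex.ofReal_injective
  rw [fejerMean_eq_sum hc, fejerMean_eq_sum hc]
  refine congrArg _ (Finset.sum_congr rfl fun j _ => Finset.sum_congr rfl fun l _ => ?_)
  congr 1
  rw [show (((j : ℤ) - (l : ℤ) : ℤ) : ℂ) * ((θ + 2 * Real.pi : ℝ) : ℂ) * I =
      (((j : ℤ) - (l : ℤ) : ℤ) : ℂ) * θ * I + (((j : ℤ) - (l : ℤ) : ℤ) : ℂ) * (2 * Real.pi * I) by
    push_cast; ring, Complex.exp_add, Complex.exp_int_mul_two_pi_mul_I, mul_one]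

/-- **Substitution form**: `σ_N h(θ) = (2π)⁻¹ ∫_{-π}^{π} K_N(s) h(θ - s) ds` for periodic `h`. [folklore] -/
theorem fejerMean_eq_integral_sub {h : ℝ → ℝ} (hp : Function.Periodic h (2 * Real.pi)) (N : ℕ)
    (θ : ℝ) : fejerMean N h θ =
      (2 * Real.pi)⁻¹ * ∫ s in (-Real.pi)..Real.pi, fejerKernel N s * h (θ - s) := by
  unfold fejerMean
  congr 1
  have hsub := intervalIntegral.integral_comp_sub_left
    (fun u => fejerKernel N u * h (θ - u)) θ (a := -Real.pi) (b := Real.pi)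
  simp only [sub_sub_cancel] at hsub
  rw [hsub]
  have hperg : Function.Periodic (fun u => fejerKernel N u * h (θ - u)) (2 * Real.pi) := by
    intro u
    simp only
    rw [fejerKernel_periodic, show θ - (u + 2 * Real.pi) = θ - u - 2 * Real.pi by ring, hp.sub_eq]
  have := hperg.intervalIntegral_add_eq (θ - Real.pi) (-Real.pi)
  rw [show θ - Real.pi + 2 * Real.pi = θ + Real.pi by ring,
    show -Real.pi + 2 * Real.pi = Real.pi by ring] at this
  rw [show θ - -Real.pi = θ + Real.pi by ring, this]

/-- The kernel bound `K_N(s) · 4 sin²(s/2) ≤ 4/(N+1)`, from the closed form of the geometric sum. [folklore] -/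
theorem fejerKernel_mul_sin_sq_le (N : ℕ) (s : ℝ) :
    fejerKernel N s * (2 * Real.sin (s / 2)) ^ 2 ≤ 4 / (N + 1) := by
  have hgeom : dirichletSum N s * (Complex.exp (s * I) - 1) = Complex.exp ((N + 1 : ℕ) * (s * I)) - 1 := by
    unfold dirichletSum
    rw [Complex.exp_nat_mul, ← geom_sum_mul]
    congr 1
    refine Finset.sum_congr rfl fun j _ => ?_
    rw [← Complex.exp_nat_mul]; congr 1; ring
  have hnorm : ‖dirichletSum N s‖ * ‖2 * Real.sin (s / 2)‖ ≤ 2 := by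
    rw [← Complex.norm_exp_I_mul_ofReal_sub_one, mul_comm I, ← norm_mul, hgeom]
    calc ‖Complex.exp ((N + 1 : ℕ) * (s * I)) - 1‖ ≤ ‖Complex.exp ((N + 1 : ℕ) * (s * I))‖ + ‖(1 : ℂ)‖ :=
          norm_sub_le _ _
      _ = 2 := by
          rw [show ((N + 1 : ℕ) : ℂ) * (s * I) = (((N + 1 : ℕ) * s : ℝ) : ℂ) * I by push_cast; ring,
            Complex.norm_exp_ofReal_mul_I]; norm_num
  have h2 : (‖dirichletSum N s‖ * ‖2 * Real.sin (s / 2)‖) ^ 2 ≤ 2 ^ 2 :=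
    pow_le_pow_left₀ (by positivity) hnorm 2
  unfold fejerKernel
  rw [div_mul_eq_mul_div]
  refine div_le_div_of_nonneg_right ?_ (by positivity)
  rw [mul_pow, Real.norm_eq_abs, sq_abs] at h2
  nlinarith [h2]

/-- Off a neighbourhood of `0` the Fejér kernel is uniformly small:
`K_N(t) ≤ 4 / ((N+1) (2 sin(δ/2))²)` for `δ ≤ |t| ≤ π`, `0 < δ ≤ π`. [folklore] -/
theorem fejerKernel_le_of_le_abs (N : ℕ) {δ t : ℝ} (hδ : 0 < δ) (hδπ : δ ≤ Real.pi)
    (ht : δ ≤ |t|) (htπ : |t| ≤ Real.pi) :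
    fejerKernel N t ≤ 4 / ((N + 1) * (2 * Real.sin (δ / 2)) ^ 2) := by
  have hsδ : 0 < Real.sin (δ / 2) := Real.sin_pos_of_pos_of_lt_pi (by linarith) (by linarith)
  -- `sin(δ/2) ≤ |sin(t/2)|`
  have hst : Real.sin (δ / 2) ≤ |Real.sin (t / 2)| := by
    have hmono : Real.sin (δ / 2) ≤ Real.sin (|t| / 2) :=
      Real.sin_le_sin_of_le_of_le_pi_div_two (by linarith) (by linarith) (by linarith)
    rcases le_or_gt 0 t with h0 | h0
    · rw [abs_of_nonneg h0] at hmono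
      exact hmono.trans (le_abs_self _)
    · rw [abs_of_neg h0] at hmono
      rw [show Real.sin (t / 2) = -Real.sin (-t / 2) by rw [neg_div, Real.sin_neg, neg_neg]]
      rw [abs_neg]
      exact hmono.trans (le_abs_self _)
  have hq : (2 * Real.sin (δ / 2)) ^ 2 ≤ (2 * Real.sin (t / 2)) ^ 2 := by
    rw [← sq_abs (2 * Real.sin (t / 2)), abs_mul, abs_of_pos (two_pos : (0 : ℝ) < 2)]
    exact pow_le_pow_left₀ (by positivity) (by linarith) 2
  have hqpos : 0 < (2 * Real.sin (δ / 2)) ^ 2 := by positivity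
  have hK := fejerKernel_mul_sin_sq_le N t
  have hK0 := fejerKernel_nonneg N t
  rw [le_div_iff₀ (by positivity)]
  calc fejerKernel N t * ((N + 1) * (2 * Real.sin (δ / 2)) ^ 2)
      = (fejerKernel N t * (2 * Real.sin (δ / 2)) ^ 2) * (N + 1) := by ring
    _ ≤ (fejerKernel N t * (2 * Real.sin (t / 2)) ^ 2) * (N + 1) := by gcongr
    _ ≤ 4 / (N + 1) * (N + 1) := by gcongr
    _ = 4 := by field_simp

/-- **Fejér's theorem**: the Fejér means of a continuous `2π`-periodic function converge to it
uniformly. [folklore] -/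
theorem tendstoUniformly_fejerMean {h : ℝ → ℝ} (hc : Continuous h)
    (hp : Function.Periodic h (2 * Real.pi)) :
    TendstoUniformly (fun N => fejerMean N h) h atTop := by
  rw [Metric.tendstoUniformly_iff]
  intro ε hε
  obtain ⟨B, hB⟩ := exists_norm_le_of_periodic hc hp
  have hB0 : 0 ≤ B := (norm_nonneg _).trans (hB 0)
  obtain ⟨δ, hδ, hU⟩ := exists_forall_dist_lt_of_periodic hc hp (half_pos hε)
  set δ' := min δ Real.pi with hδ'
  have hδ'0 : 0 < δ' := lt_min hδ Real.pi_pos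
  have hδ'π : δ' ≤ Real.pi := min_le_right _ _
  set c : ℝ := (2 * Real.sin (δ' / 2)) ^ 2 with hcdef
  have hc0 : 0 < c := by
    have : 0 < Real.sin (δ' / 2) := Real.sin_pos_of_pos_of_lt_pi (by linarith) (by linarith)
    positivity
  -- choose `N₀` with `2B · 4/((N+1)c) < ε/2` for `N ≥ N₀`
  obtain ⟨N₀, hN₀⟩ := exists_nat_gt (16 * B / (c * ε))
  filter_upwards [Filter.eventually_ge_atTop N₀] with N hN θ
  set C : ℝ := 2 * B * (4 / ((N + 1) * c)) with hCdef
  have hC0 : 0 ≤ C := by positivity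
  have hCε : C < ε / 2 := by
    have hN' : (16 * B / (c * ε) : ℝ) < N + 1 := by
      have : (N₀ : ℝ) ≤ N := by exact_mod_cast hN
      linarith
    rw [hCdef]
    rw [div_lt_iff₀ (by positivity)] at hN'
    rw [show 2 * B * (4 / ((N + 1) * c)) = 8 * B / ((N + 1) * c) by ring,
      div_lt_iff₀ (by positivity)]
    nlinarith
  -- the difference as one integral
  have hKc := continuous_fejerKernel N
  have hdiff : fejerMean N h θ - h θ = (2 * Real.pi)⁻¹ *
      ∫ s in (-Real.pi)..Real.pi, fejerKernel N s * (h (θ - s) - h θ) := by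
    rw [fejerMean_eq_integral_sub hp]
    have h1 : h θ = (2 * Real.pi)⁻¹ * ∫ s in (-Real.pi)..Real.pi, fejerKernel N s * h θ := by
      rw [intervalIntegral.integral_mul_const, ← mul_assoc, integral_fejerKernel, one_mul]
    conv_lhs => rw [h1]
    rw [← mul_sub, ← intervalIntegral.integral_sub]
    · congr 1
      refine intervalIntegral.integral_congr fun s _ => ?_
      ring
    · exact Continuous.intervalIntegrable (by fun_prop) _ _
    · exact Continuous.intervalIntegrable (by fun_prop) _ _
  -- pointwise bound on `(-π, π]`
  have hpt : ∀ t ∈ Set.Ioc (-Real.pi) Real.pi,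
      ‖fejerKernel N t * (h (θ - t) - h θ)‖ ≤ fejerKernel N t * (ε / 2) + C := by
    intro t ht
    have hK0 := fejerKernel_nonneg N t
    rw [norm_mul, Real.norm_of_nonneg hK0]
    rcases lt_or_ge |t| δ' with hlt | hge
    · have hlt' : |θ - t - θ| < δ := by
        rw [show θ - t - θ = -t by ring, abs_neg]
        exact lt_of_lt_of_le hlt (min_le_left _ _)
      have hu : |h (θ - t) - h θ| < ε / 2 := by
        have := hU (θ - t) θ hlt'
        rwa [Real.dist_eq] at this
      calc fejerKernel N t * ‖h (θ - t) - h θ‖ ≤ fejerKernel N t * (ε / 2) := by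
            rw [Real.norm_eq_abs]; gcongr
        _ ≤ fejerKernel N t * (ε / 2) + C := le_add_of_nonneg_right hC0
    · have htπ : |t| ≤ Real.pi := abs_le.2 ⟨by linarith [ht.1], ht.2⟩
      have hKt := fejerKernel_le_of_le_abs N hδ'0 hδ'π hge htπ
      have h2B : ‖h (θ - t) - h θ‖ ≤ 2 * B :=
        (norm_sub_le _ _).trans (by linarith [hB (θ - t), hB θ])
      calc fejerKernel N t * ‖h (θ - t) - h θ‖ ≤ 4 / ((N + 1) * c) * (2 * B) := by gcongr
        _ = C := by rw [hCdef]; ring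
        _ ≤ fejerKernel N t * (ε / 2) + C := le_add_of_nonneg_left (by positivity)
  have hint := intervalIntegral.norm_integral_le_of_norm_le (μ := volume)
    (f := fun t => fejerKernel N t * (h (θ - t) - h θ))
    (g := fun t => fejerKernel N t * (ε / 2) + C) (by linarith [Real.pi_pos])
    (Eventually.of_forall hpt) (Continuous.intervalIntegrable (by fun_prop) _ _)
  have hg : (∫ t in (-Real.pi)..Real.pi, (fejerKernel N t * (ε / 2) + C)) =
      2 * Real.pi * (ε / 2) + 2 * Real.pi * C := by
    rw [intervalIntegral.integral_add (Continuous.intervalIntegrable (by fun_prop) _ _)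
      (Continuous.intervalIntegrable (by fun_prop) _ _), intervalIntegral.integral_mul_const,
      intervalIntegral.integral_const]
    have hI : (∫ t in (-Real.pi)..Real.pi, fejerKernel N t) = 2 * Real.pi := by
      have := integral_fejerKernel N
      field_simp at this
      linarith
    rw [hI, smul_eq_mul]
    ring
  rw [hg] at hint
  rw [Real.dist_eq, abs_sub_comm, hdiff, abs_mul, abs_of_pos (inv_pos.2 Real.two_pi_pos)]
  calc (2 * Real.pi)⁻¹ * |∫ s in (-Real.pi)..Real.pi, fejerKernel N s * (h (θ - s) - h θ)|
      ≤ (2 * Real.pi)⁻¹ * (2 * Real.pi * (ε / 2) + 2 * Real.pi * C) := by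
        gcongr; exact hint
    _ = ε / 2 + C := by field_simp
    _ < ε := by linarith

end Fejer

/-! ### The functional `Φ_n(g) = log D_n(e^g) - n · mean(g)` on real symbols -/

section LogSzego

/-- The mean `(2π)⁻¹ ∫_{-π}^{π} g`. [folklore] -/
def symbolMean (g : ℝ → ℝ) : ℝ := (2 * Real.pi)⁻¹ * ∫ θ in (-Real.pi)..Real.pi, g θ

/-- **The logarithm of the normalised Toeplitz determinant** of the positive symbol `e^g`:
`Φ_n(g) = log D_n(e^g) - n (2π)⁻¹ ∫ g` (`= log (D_n(e^g)/G(e^g)^n)`, `G` the geometric mean). [folklore] -/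
def logSzego (n : ℕ) (g : ℝ → ℝ) : ℝ :=
  Real.log (toeplitzDet (circleCoeff fun θ => (Real.exp (g θ) : ℂ)) n).re - n * symbolMean g

/-- Linearity of the mean. [folklore] -/
theorem symbolMean_add {g₁ g₂ : ℝ → ℝ} (h₁ : Continuous g₁) (h₂ : Continuous g₂) (a b : ℝ) :
    symbolMean (fun θ => a * g₁ θ + b * g₂ θ) = a * symbolMean g₁ + b * symbolMean g₂ := by
  unfold symbolMean
  rw [intervalIntegral.integral_add (Continuous.intervalIntegrable (by fun_prop) _ _)
    (Continuous.intervalIntegrable (by fun_prop) _ _), intervalIntegral.integral_const_mul,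
    intervalIntegral.integral_const_mul]
  ring

/-- Translation invariance of the mean of a periodic symbol. [folklore] -/
theorem symbolMean_comp_sub {g : ℝ → ℝ} (hp : Function.Periodic g (2 * Real.pi)) (s : ℝ) :
    symbolMean (fun θ => g (θ - s)) = symbolMean g := by
  unfold symbolMean
  congr 1
  rw [intervalIntegral.integral_comp_sub_right (fun θ => g θ) s]
  have := hp.intervalIntegral_add_eq (-Real.pi - s) (-Real.pi)
  rw [show -Real.pi - s + 2 * Real.pi = Real.pi - s by ring,
    show -Real.pi + 2 * Real.pi = Real.pi by ring] at this
  exact this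

/-- The mean of a finite linear combination. [folklore] -/
theorem symbolMean_finset_sum {ι : Type*} (S : Finset ι) (w : ι → ℝ) (g : ι → ℝ → ℝ)
    (hg : ∀ i ∈ S, Continuous (g i)) :
    symbolMean (fun θ => ∑ i ∈ S, w i * g i θ) = ∑ i ∈ S, w i * symbolMean (g i) := by
  unfold symbolMean
  rw [intervalIntegral.integral_finsetSum (fun i hi =>
    (Continuous.intervalIntegrable (by have := hg i hi; fun_prop) _ _)), Finset.mul_sum]
  refine Finset.sum_congr rfl fun i _ => ?_
  rw [intervalIntegral.integral_const_mul]
  ring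

/-- `|mean g - mean g'| ≤ sup |g - g'|`. [folklore] -/
theorem abs_symbolMean_sub_le {g g' : ℝ → ℝ} (hg : Continuous g) (hg' : Continuous g') {ε : ℝ}
    (h : ∀ θ, |g θ - g' θ| ≤ ε) : |symbolMean g - symbolMean g'| ≤ ε := by
  have hε : 0 ≤ ε := (abs_nonneg _).trans (h 0)
  unfold symbolMean
  rw [← mul_sub, ← intervalIntegral.integral_sub (hg.intervalIntegrable _ _)
    (hg'.intervalIntegrable _ _), abs_mul, abs_of_pos (inv_pos.2 Real.two_pi_pos)]
  have := intervalIntegral.norm_integral_le_of_norm_le_const (a := -Real.pi) (b := Real.pi)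
    (f := fun θ => g θ - g' θ) (C := ε) fun θ _ => h θ
  rw [show Real.pi - -Real.pi = 2 * Real.pi by ring, abs_of_pos Real.two_pi_pos,
    Real.norm_eq_abs] at this
  calc (2 * Real.pi)⁻¹ * |∫ θ in (-Real.pi)..Real.pi, g θ - g' θ|
      ≤ (2 * Real.pi)⁻¹ * (ε * (2 * Real.pi)) := by gcongr
    _ = ε := by field_simp

/-- **Convexity of `Φ_n`** on continuous real symbols. [folklore] -/
theorem logSzego_convex (n : ℕ) {g₁ g₂ : ℝ → ℝ} (h₁ : Continuous g₁) (h₂ : Continuous g₂)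
    {a b : ℝ} (ha : 0 ≤ a) (hb : 0 ≤ b) (hab : a + b = 1) :
    logSzego n (fun θ => a * g₁ θ + b * g₂ θ) ≤ a * logSzego n g₁ + b * logSzego n g₂ := by
  unfold logSzego
  rw [symbolMean_add h₁ h₂]
  have := log_toeplitzDet_exp_convex h₁ h₂ n ha hb hab
  nlinarith [this]

/-- `Φ_n` as a convex function on the convex set of continuous symbols. [folklore] -/
theorem convexOn_logSzego (n : ℕ) :
    ConvexOn ℝ {g : ℝ → ℝ | Continuous g} (logSzego n) := by
  refine ⟨fun g₁ h₁ g₂ h₂ a b _ _ _ => ?_, fun g₁ h₁ g₂ h₂ a b ha hb hab => ?_⟩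
  · exact (Continuous.add (h₁.const_smul a) (h₂.const_smul b) : Continuous (a • g₁ + b • g₂))
  · exact logSzego_convex n h₁ h₂ ha hb hab

/-- **Finite Jensen inequality for `Φ_n`**. [folklore] -/
theorem logSzego_sum_le (n : ℕ) {ι : Type*} (S : Finset ι) (w : ι → ℝ) (g : ι → ℝ → ℝ)
    (hw : ∀ i ∈ S, 0 ≤ w i) (hw1 : ∑ i ∈ S, w i = 1) (hg : ∀ i ∈ S, Continuous (g i)) :
    logSzego n (fun θ => ∑ i ∈ S, w i * g i θ) ≤ ∑ i ∈ S, w i * logSzego n (g i) := by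
  have h := (convexOn_logSzego n).map_sum_le hw hw1 hg
  have hfun : (fun θ => ∑ i ∈ S, w i * g i θ) = ∑ i ∈ S, w i • g i := by
    funext θ; simp [Finset.sum_apply]
  rw [hfun]
  simpa only [smul_eq_mul] using h

/-- **Translation invariance of `Φ_n`**. [folklore] -/
theorem logSzego_comp_sub (n : ℕ) {g : ℝ → ℝ} (hp : Function.Periodic g (2 * Real.pi)) (s : ℝ) :
    logSzego n (fun θ => g (θ - s)) = logSzego n g := by
  unfold logSzego
  rw [symbolMean_comp_sub hp]
  have hper : Function.Periodic (fun θ => (Real.exp (g θ) : ℂ)) (2 * Real.pi) := fun θ => by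
    simp only [hp θ]
  rw [show (fun θ => (Real.exp (g (θ - s)) : ℂ)) = fun θ => (fun θ' => (Real.exp (g θ') : ℂ)) (θ - s)
    from rfl, toeplitzDet_comp_sub hper]

/-- The normalised determinant is positive: `D_n(e^g) > 0`. [folklore] -/
theorem toeplitzDet_exp_re_pos {g : ℝ → ℝ} (hg : Continuous g) (n : ℕ) :
    0 < (toeplitzDet (circleCoeff fun θ => (Real.exp (g θ) : ℂ)) n).re :=
  (toeplitzDet_pos (w := fun θ => Real.exp (g θ)) (by fun_prop) (fun θ => Real.exp_pos _) n).1

/-- **Continuity of `Φ_n` under uniform convergence** of continuous symbols to a bounded one. [folklore] -/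
theorem tendsto_logSzego {ι : Type*} {l : Filter ι} (n : ℕ) {G : ι → ℝ → ℝ} {g : ℝ → ℝ}
    (hG : ∀ i, Continuous (G i)) (hg : Continuous g) (hB : ∃ B, ∀ x, |g x| ≤ B)
    (h : TendstoUniformly G g l) : Tendsto (fun i => logSzego n (G i)) l (𝓝 (logSzego n g)) := by
  unfold logSzego
  refine Tendsto.sub ?_ (Tendsto.const_mul _ ?_)
  · -- determinants
    have hexp := tendstoUniformly_cexp_of_real hB h
    have hcoef := tendsto_circleCoeff_of_tendstoUniformly (l := l)
      (F := fun i θ => (Real.exp (G i θ) : ℂ)) (f := fun θ => (Real.exp (g θ) : ℂ))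
      (fun i => by have := hG i; fun_prop) (by fun_prop) hexp
    have hdet := tendsto_toeplitzDet_of_tendsto hcoef n
    have hre := (Complex.continuous_re.tendsto _).comp hdet
    exact (Real.continuousAt_log (toeplitzDet_exp_re_pos hg n).ne').tendsto.comp hre
  · -- means
    rw [Metric.tendsto_nhds]
    intro ε hε
    filter_upwards [Metric.tendstoUniformly_iff.1 h (ε / 2) (half_pos hε)] with i hi
    rw [Real.dist_eq]
    refine lt_of_le_of_lt (abs_symbolMean_sub_le (hG i) hg fun θ => ?_) (half_lt_self hε)
    have := (hi θ).le
    rwa [Real.dist_eq, abs_sub_comm] at this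

end LogSzego

/-! ### Riemann sums and Jensen's inequality for Fejér means -/

section Jensen

/-- Equally spaced nodes `-π + 2π m / M`. [folklore] -/
def node (M m : ℕ) : ℝ := -Real.pi + 2 * Real.pi * m / M

/-- The first node is `-π`. [folklore] -/
theorem node_zero (M : ℕ) : node M 0 = -Real.pi := by simp [node]

/-- The last node is `π`. [folklore] -/
theorem node_self {M : ℕ} (hM : 0 < M) : node M M = Real.pi := by
  unfold node
  have : (M : ℝ) ≠ 0 := by exact_mod_cast hM.ne'
  field_simp
  ring

/-- The mesh is `2π/M`. [folklore] -/
theorem node_succ_sub (M m : ℕ) (hM : 0 < M) : node M (m + 1) - node M m = 2 * Real.pi / M := by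
  unfold node
  have : (M : ℝ) ≠ 0 := by exact_mod_cast hM.ne'
  push_cast
  field_simp
  ring

/-- **Left Riemann sums** of a continuous function with modulus of continuity `ε` at scale `δ`:
`|∫_{-π}^{π} Ψ - (2π/M) ∑_{m<M} Ψ(s_m)| ≤ 2π ε` once `2π/M ≤ δ`. [folklore] -/
theorem abs_integral_sub_riemann_le {Ψ : ℝ → ℝ} (hΨ : Continuous Ψ) {ε δ : ℝ}
    (hmod : ∀ s s', |s - s'| ≤ δ → |Ψ s - Ψ s'| ≤ ε) {M : ℕ} (hM : 0 < M)
    (hMδ : 2 * Real.pi / M ≤ δ) :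
    |(∫ s in (-Real.pi)..Real.pi, Ψ s) - 2 * Real.pi / M * ∑ m ∈ Finset.range M, Ψ (node M m)| ≤
      2 * Real.pi * ε := by
  have hδ : 0 ≤ δ := le_trans (by positivity) hMδ
  have hε : 0 ≤ ε := (abs_nonneg _).trans (hmod 0 0 (by simpa using hδ))
  have hsum := intervalIntegral.sum_integral_adjacent_intervals (μ := volume) (f := Ψ) (a := node M)
    (n := M) (fun k _ => hΨ.intervalIntegrable _ _)
  rw [node_zero, node_self hM] at hsum
  rw [← hsum, Finset.mul_sum, ← Finset.sum_sub_distrib]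
  have hpiece : ∀ m ∈ Finset.range M,
      |(∫ s in node M m..node M (m + 1), Ψ s) - 2 * Real.pi / M * Ψ (node M m)| ≤
        ε * (2 * Real.pi / M) := by
    intro m _
    have hc : (∫ _ in node M m..node M (m + 1), Ψ (node M m)) = 2 * Real.pi / M * Ψ (node M m) := by
      rw [intervalIntegral.integral_const, node_succ_sub M m hM, smul_eq_mul]
    rw [← hc, ← intervalIntegral.integral_sub (hΨ.intervalIntegrable _ _)
      (continuous_const.intervalIntegrable _ _)]
    have hle : node M m ≤ node M (m + 1) := by
      have := node_succ_sub M m hM; have : (0 : ℝ) < 2 * Real.pi / M := by positivity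
      linarith
    have := intervalIntegral.norm_integral_le_of_norm_le_const (a := node M m) (b := node M (m + 1))
      (f := fun s => Ψ s - Ψ (node M m)) (C := ε) fun s hs => ?_
    · rw [node_succ_sub M m hM, abs_of_pos (by positivity)] at this
      simpa using this
    · rw [Set.uIoc_of_le hle] at hs
      rw [Real.norm_eq_abs]
      refine hmod _ _ ?_
      rw [abs_of_nonneg (by linarith [hs.1])]
      have := node_succ_sub M m hM
      linarith [hs.2]
  calc |∑ m ∈ Finset.range M, ((∫ s in node M m..node M (m + 1), Ψ s) -
        2 * Real.pi / M * Ψ (node M m))|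
      ≤ ∑ m ∈ Finset.range M, |(∫ s in node M m..node M (m + 1), Ψ s) -
        2 * Real.pi / M * Ψ (node M m)| := Finset.abs_sum_le_sum_abs _ _
    _ ≤ ∑ _m ∈ Finset.range M, ε * (2 * Real.pi / M) := Finset.sum_le_sum hpiece
    _ = 2 * Real.pi * ε := by
        rw [Finset.sum_const, Finset.card_range, nsmul_eq_mul]
        have : (M : ℝ) ≠ 0 := by exact_mod_cast hM.ne'
        field_simp

/-- **Jensen's inequality for Fejér means**: averaging a symbol over translations can only
decrease the convex, translation-invariant functional `Φ_n`: `Φ_n(σ_N h) ≤ Φ_n(h)`. [folklore] -/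
theorem logSzego_fejerMean_le (n N : ℕ) {h : ℝ → ℝ} (hc : Continuous h)
    (hp : Function.Periodic h (2 * Real.pi)) :
    logSzego n (fejerMean N h) ≤ logSzego n h := by
  set K := fejerKernel N with hKdef
  have hKc : Continuous K := continuous_fejerKernel N
  have hKp : Function.Periodic K (2 * Real.pi) := fejerKernel_periodic N
  have hK0 : ∀ s, 0 ≤ K s := fejerKernel_nonneg N
  obtain ⟨Bh, hBh⟩ := exists_norm_le_of_periodic hc hp
  obtain ⟨BK, hBK⟩ := exists_norm_le_of_periodic hKc hKp
  have hBh0 : 0 ≤ Bh := (norm_nonneg _).trans (hBh 0)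
  have hBK0 : 0 ≤ BK := (norm_nonneg _).trans (hBK 0)
  have hIK : (∫ s in (-Real.pi)..Real.pi, K s) = 2 * Real.pi := by
    have := integral_fejerKernel N
    field_simp at this
    linarith
  -- Riemann sums
  set R : ℕ → ℝ → ℝ := fun M θ =>
    2 * Real.pi / M * ∑ m ∈ Finset.range M, K (node M m) * h (θ - node M m) with hR
  set Z : ℕ → ℝ := fun M => 2 * Real.pi / M * ∑ m ∈ Finset.range M, K (node M m) with hZ
  set G : ℕ → ℝ → ℝ := fun M θ => R M θ / Z M with hG
  -- a device producing `M` with `2π/M ≤ δ/2`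
  have hev : ∀ {δ : ℝ}, 0 < δ → ∀ᶠ M : ℕ in atTop, 0 < M ∧ 2 * Real.pi / M ≤ δ / 2 := by
    intro δ hδ
    obtain ⟨M₀, hM₀⟩ := exists_nat_gt (4 * Real.pi / δ)
    filter_upwards [eventually_ge_atTop (M₀ + 1)] with M hM
    have hM' : (M₀ : ℝ) + 1 ≤ M := by exact_mod_cast hM
    have hMpos : (0 : ℝ) < M := by linarith [(Nat.cast_nonneg M₀ : (0 : ℝ) ≤ M₀)]
    refine ⟨by exact_mod_cast hMpos, ?_⟩
    rw [div_le_iff₀ hMpos]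
    rw [div_lt_iff₀ hδ] at hM₀
    nlinarith
  -- (1) `Z M → 2π`
  have hZlim : ∀ ε > 0, ∀ᶠ M : ℕ in atTop, |2 * Real.pi - Z M| ≤ 2 * Real.pi * ε := by
    intro ε hε
    obtain ⟨δ, hδ, hU⟩ := exists_forall_dist_lt_of_periodic hKc hKp hε
    filter_upwards [hev hδ] with M hM
    have := abs_integral_sub_riemann_le hKc (ε := ε) (δ := δ / 2) (fun s s' hss' => ?_) hM.1 hM.2
    · rw [hIK] at this
      exact this
    · have := (hU s s' (by linarith)).le
      rwa [Real.dist_eq] at this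
  -- (2) `R M θ → ∫ K(s) h(θ - s) ds` uniformly in `θ`
  have hRlim : ∀ ε > 0, ∀ᶠ M : ℕ in atTop, ∀ θ,
      |(∫ s in (-Real.pi)..Real.pi, K s * h (θ - s)) - R M θ| ≤ 2 * Real.pi * ε := by
    intro ε hε
    obtain ⟨δK, hδK, hUK⟩ := exists_forall_dist_lt_of_periodic hKc hKp
      (show 0 < ε / (2 * (Bh + 1)) by positivity)
    obtain ⟨δh, hδh, hUh⟩ := exists_forall_dist_lt_of_periodic hc hp
      (show 0 < ε / (2 * (BK + 1)) by positivity)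
    filter_upwards [hev (lt_min hδK hδh)] with M hM θ
    refine abs_integral_sub_riemann_le (Ψ := fun s => K s * h (θ - s)) (by fun_prop) (ε := ε)
      (δ := min δK δh / 2) (fun s s' hss' => ?_) hM.1 hM.2
    have h1 : |K s - K s'| < ε / (2 * (Bh + 1)) := by
      have := hUK s s' (by linarith [min_le_left δK δh]); rwa [Real.dist_eq] at this
    have hss'' : |θ - s - (θ - s')| < δh := by
      rw [show θ - s - (θ - s') = -(s - s') by ring, abs_neg]
      linarith [min_le_right δK δh]
    have h2 : |h (θ - s) - h (θ - s')| < ε / (2 * (BK + 1)) := by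
      have := hUh (θ - s) (θ - s') hss''
      rwa [Real.dist_eq] at this
    have hhb : |h (θ - s)| ≤ Bh := hBh _
    have hKb : |K s'| ≤ BK := hBK _
    rw [show K s * h (θ - s) - K s' * h (θ - s') =
      (K s - K s') * h (θ - s) + K s' * (h (θ - s) - h (θ - s')) by ring]
    calc |(K s - K s') * h (θ - s) + K s' * (h (θ - s) - h (θ - s'))|
        ≤ |K s - K s'| * |h (θ - s)| + |K s'| * |h (θ - s) - h (θ - s')| := by
          refine (abs_add_le _ _).trans ?_; rw [abs_mul, abs_mul]
      _ ≤ ε / (2 * (Bh + 1)) * Bh + BK * (ε / (2 * (BK + 1))) := by gcongr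
      _ ≤ ε / 2 + ε / 2 := by
          refine add_le_add ?_ ?_
          · calc ε / (2 * (Bh + 1)) * Bh ≤ ε / (2 * (Bh + 1)) * (Bh + 1) := by gcongr; linarith
              _ = ε / 2 := by field_simp
          · calc BK * (ε / (2 * (BK + 1))) ≤ (BK + 1) * (ε / (2 * (BK + 1))) := by gcongr; linarith
              _ = ε / 2 := by field_simp
      _ = ε := by ring
  -- (3) eventually `Z M ≥ π`
  have hZpos : ∀ᶠ M : ℕ in atTop, Real.pi ≤ Z M := by
    filter_upwards [hZlim (1 / 4) (by norm_num)] with M hM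
    rw [abs_le] at hM
    linarith [Real.pi_pos]
  -- (4) Jensen at the discrete level
  have hJ : ∀ᶠ M : ℕ in atTop, logSzego n (G M) ≤ logSzego n h := by
    filter_upwards [hZpos] with M hM
    have hZ0 : 0 < Z M := lt_of_lt_of_le Real.pi_pos hM
    set p : ℕ → ℝ := fun m => 2 * Real.pi / M * K (node M m) / Z M with hpdef
    have hGp : G M = fun θ => ∑ m ∈ Finset.range M, p m * h (θ - node M m) := by
      funext θ
      rw [hG, hR]
      simp only [hpdef]
      rw [Finset.mul_sum, Finset.sum_div]
      refine Finset.sum_congr rfl fun m _ => ?_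
      ring
    have hp0 : ∀ m ∈ Finset.range M, 0 ≤ p m := fun m _ => by
      rw [hpdef]; exact div_nonneg (mul_nonneg (by positivity) (hK0 _)) hZ0.le
    have hp1 : ∑ m ∈ Finset.range M, p m = 1 := by
      simp only [hpdef]
      rw [← Finset.sum_div, ← Finset.mul_sum]
      exact div_self hZ0.ne'
    rw [hGp]
    calc logSzego n (fun θ => ∑ m ∈ Finset.range M, p m * h (θ - node M m))
        ≤ ∑ m ∈ Finset.range M, p m * logSzego n (fun θ => h (θ - node M m)) :=
          logSzego_sum_le n _ p (fun m θ => h (θ - node M m)) hp0 hp1 (fun m _ => by fun_prop)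
      _ = logSzego n h := by
          simp_rw [logSzego_comp_sub n hp, ← Finset.sum_mul, hp1, one_mul]
  -- (5) `G M → σ_N h` uniformly
  have hI : ∀ θ, |∫ s in (-Real.pi)..Real.pi, K s * h (θ - s)| ≤ BK * Bh * (2 * Real.pi) := by
    intro θ
    have := intervalIntegral.norm_integral_le_of_norm_le_const (a := -Real.pi) (b := Real.pi)
      (f := fun s => K s * h (θ - s)) (C := BK * Bh) fun s _ => by
        rw [norm_mul]; exact mul_le_mul (hBK s) (hBh _) (norm_nonneg _) hBK0
    rwa [show Real.pi - -Real.pi = 2 * Real.pi by ring, abs_of_pos Real.two_pi_pos,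
      Real.norm_eq_abs] at this
  have hGlim : TendstoUniformly G (fejerMean N h) atTop := by
    rw [Metric.tendstoUniformly_iff]
    intro η hη
    set ε : ℝ := η / (4 * (1 + BK * Bh)) with hεdef
    have hε : 0 < ε := by positivity
    filter_upwards [hZlim ε hε, hRlim ε hε, hZpos] with M hZM hRM hZπ θ
    have hZ0 : 0 < Z M := lt_of_lt_of_le Real.pi_pos hZπ
    rw [Real.dist_eq, fejerMean_eq_integral_sub hp N θ]
    set I := ∫ s in (-Real.pi)..Real.pi, K s * h (θ - s) with hIdef
    have hdec : (2 * Real.pi)⁻¹ * I - G M θ =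
        (I - R M θ) / Z M + I * ((Z M - 2 * Real.pi) / (2 * Real.pi * Z M)) := by
      rw [hG]
      field_simp
      ring
    rw [hdec]
    have hRθ := hRM θ
    calc |(I - R M θ) / Z M + I * ((Z M - 2 * Real.pi) / (2 * Real.pi * Z M))|
        ≤ |I - R M θ| / Z M + |I| * (|Z M - 2 * Real.pi| / (2 * Real.pi * Z M)) := by
          refine (abs_add_le _ _).trans ?_
          rw [abs_div, abs_of_pos hZ0, abs_mul, abs_div,
            abs_of_pos (mul_pos Real.two_pi_pos hZ0)]
      _ ≤ (2 * Real.pi * ε) / Real.pi + BK * Bh * (2 * Real.pi) *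
          ((2 * Real.pi * ε) / (2 * Real.pi * Real.pi)) := by
          have hZM' : |Z M - 2 * Real.pi| ≤ 2 * Real.pi * ε := by rw [abs_sub_comm]; exact hZM
          refine add_le_add ?_ ?_
          · calc |I - R M θ| / Z M ≤ (2 * Real.pi * ε) / Z M :=
                  div_le_div_of_nonneg_right hRθ hZ0.le
              _ ≤ (2 * Real.pi * ε) / Real.pi :=
                  div_le_div_of_nonneg_left (by positivity) Real.pi_pos hZπ
          · refine mul_le_mul (hI θ) ?_ (by positivity) (by positivity)
            calc |Z M - 2 * Real.pi| / (2 * Real.pi * Z M)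
                ≤ (2 * Real.pi * ε) / (2 * Real.pi * Z M) :=
                  div_le_div_of_nonneg_right hZM' (by positivity)
              _ ≤ (2 * Real.pi * ε) / (2 * Real.pi * Real.pi) :=
                  div_le_div_of_nonneg_left (by positivity) (by positivity)
                    (by nlinarith [hZπ, Real.pi_pos])
      _ = 2 * ε * (1 + BK * Bh) := by field_simp
      _ = η / 2 := by rw [hεdef]; field_simp; ring
      _ < η := half_lt_self hη
  -- (6) continuity of the approximants and pass to the limit
  have hGc : ∀ M, Continuous (G M) := fun M => by
    simp only [hG, hR]
    fun_prop
  obtain ⟨Bσ, hBσ⟩ := exists_norm_le_of_periodic (continuous_fejerMean hc N) (fejerMean_periodic hc N)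
  have hlim := tendsto_logSzego n hGc (continuous_fejerMean hc N) ⟨Bσ, fun x => hBσ x⟩ hGlim
  exact le_of_tendsto hlim hJ

end Jensen

/-! ### The real case of the strong Szegő limit theorem -/

section RealCase

/-- The Szegő sum `∑_{k ≥ 1} k |g_k|²` of a real symbol (`= ∑ k g_k g_{-k}`). [folklore] -/
def szegoSum (g : ℝ → ℝ) : ℝ :=
  ∑' k : ℕ, ((k : ℝ) + 1) * ‖circleCoeff (fun θ => (g θ : ℂ)) ((k : ℤ) + 1)‖ ^ 2

/-- The zeroth coefficient of a real symbol is its mean. [folklore] -/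
theorem circleCoeff_ofReal_zero (g : ℝ → ℝ) :
    circleCoeff (fun θ => (g θ : ℂ)) 0 = (symbolMean g : ℂ) := by
  unfold circleCoeff symbolMean
  simp only [Int.cast_zero, zero_mul, neg_zero, Complex.exp_zero, one_mul,
    intervalIntegral.integral_ofReal]
  push_cast
  ring

/-- **Bridge (real symbols)**: `D_n(e^g)/e^{n g_0} = exp Φ_n(g)` as a complex number. [folklore] -/
theorem szegoQuot_ofReal {g : ℝ → ℝ} (hg : Continuous g) (n : ℕ) :
    toeplitzDet (circleCoeff fun θ => Complex.exp ((g θ : ℂ))) n /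
        Complex.exp (n * circleCoeff (fun θ => (g θ : ℂ)) 0) =
      ((Real.exp (logSzego n g) : ℝ) : ℂ) := by
  have hexp : (fun θ => Complex.exp ((g θ : ℂ))) = fun θ => ((Real.exp (g θ) : ℝ) : ℂ) := by
    funext θ; exact (Complex.ofReal_exp _).symm
  rw [hexp, circleCoeff_ofReal_zero]
  obtain ⟨hpos, him⟩ := toeplitzDet_pos (w := fun θ => Real.exp (g θ)) (by fun_prop)
    (fun θ => Real.exp_pos _) n
  set D := toeplitzDet (circleCoeff fun θ => ((Real.exp (g θ) : ℝ) : ℂ)) n with hDdef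
  have hD : D = ((D.re : ℝ) : ℂ) := Complex.ext rfl (by simp [him])
  rw [hD, logSzego, Real.exp_sub, Real.exp_log hpos]
  push_cast
  rfl

/-- **Bridge (real symbols)**: `exp(∑ k g_k g_{-k}) = exp(∑ k |g_k|²)`. [folklore] -/
theorem szegoConst_ofReal (g : ℝ → ℝ) :
    Complex.exp (∑' k : ℕ, ((k : ℂ) + 1) * circleCoeff (fun θ => (g θ : ℂ)) ((k : ℤ) + 1) *
        circleCoeff (fun θ => (g θ : ℂ)) (-((k : ℤ) + 1))) =
      ((Real.exp (szegoSum g) : ℝ) : ℂ) := by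
  rw [Complex.ofReal_exp, szegoSum, Complex.ofReal_tsum]
  congr 1
  refine tsum_congr fun k => ?_
  rw [← conj_circleCoeff_ofReal g ((k : ℤ) + 1), mul_assoc, Complex.mul_conj,
    Complex.normSq_eq_norm_sq]
  push_cast
  ring

/-- Geometric decay of the coefficients makes the Szegő sum (absolutely) convergent. [folklore] -/
theorem summable_szegoSum_of_geometric {g : ℝ → ℝ} {C r : ℝ} (hr : 0 ≤ r) (hr1 : r < 1)
    (hcoeff : ∀ k, ‖circleCoeff (fun θ => (g θ : ℂ)) k‖ ≤ C * r ^ k.natAbs) :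
    Summable fun k : ℕ => ((k : ℝ) + 1) * ‖circleCoeff (fun θ => (g θ : ℂ)) ((k : ℤ) + 1)‖ ^ 2 := by
  have hC : ∀ k, ‖circleCoeff (fun θ => (g θ : ℂ)) k‖ ≤ |C| * r ^ k.natAbs := fun k =>
    (hcoeff k).trans (mul_le_mul_of_nonneg_right (le_abs_self C) (pow_nonneg hr _))
  have hgeom : Summable fun k : ℕ => ((k : ℝ) ^ 1 * (r ^ 2) ^ k) :=
    summable_pow_mul_geometric_of_norm_lt_one 1 (by
      rw [Real.norm_of_nonneg (sq_nonneg r)]; nlinarith)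
  have hs : Summable fun k : ℕ => |C| ^ 2 * (((k + 1 : ℕ) : ℝ) ^ 1 * (r ^ 2) ^ (k + 1)) :=
    ((summable_nat_add_iff 1).2 hgeom).mul_left _
  refine Summable.of_nonneg_of_le (fun k => by positivity) (fun k => ?_) hs
  have hk := hC ((k : ℤ) + 1)
  have hna : ((k : ℤ) + 1).natAbs = k + 1 := by omega
  rw [hna] at hk
  have h0 : 0 ≤ ‖circleCoeff (fun θ => (g θ : ℂ)) ((k : ℤ) + 1)‖ := norm_nonneg _
  calc ((k : ℝ) + 1) * ‖circleCoeff (fun θ => (g θ : ℂ)) ((k : ℤ) + 1)‖ ^ 2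
      ≤ ((k : ℝ) + 1) * (|C| * r ^ (k + 1)) ^ 2 := by gcongr
    _ = |C| ^ 2 * (((k + 1 : ℕ) : ℝ) ^ 1 * (r ^ 2) ^ (k + 1)) := by push_cast; ring

/-- **The geometric case, real form** (the tree's `strongSzego_geometric`):
`exp Φ_n(g) → exp(∑ k |g_k|²)`. [cite: DeiftItsKrasovsky2013, §3, Theorem 7] -/
theorem tendsto_exp_logSzego_of_geometric {g : ℝ → ℝ} (hc : Continuous g)
    (hp : Function.Periodic g (2 * Real.pi)) {C r : ℝ} (hr : 0 ≤ r) (hr1 : r < 1)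
    (hcoeff : ∀ k, ‖circleCoeff (fun θ => (g θ : ℂ)) k‖ ≤ C * r ^ k.natAbs) :
    Tendsto (fun n => Real.exp (logSzego n g)) atTop (𝓝 (Real.exp (szegoSum g))) := by
  have hpC : Function.Periodic (fun θ => (g θ : ℂ)) (2 * Real.pi) := fun θ => by simp [hp θ]
  have h := strongSzego_geometric (V := fun θ => (g θ : ℂ)) (by fun_prop) hpC hr hr1 hcoeff
  have hfun : (fun n : ℕ => toeplitzDet (circleCoeff fun θ => Complex.exp ((g θ : ℂ))) n /
      Complex.exp (n * circleCoeff (fun θ => (g θ : ℂ)) 0)) =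
      fun n => ((Real.exp (logSzego n g) : ℝ) : ℂ) := funext (szegoQuot_ofReal hc)
  rw [hfun, szegoConst_ofReal] at h
  have h' := (Complex.continuous_re.tendsto _).comp h
  simpa only [Function.comp_def, Complex.ofReal_re] using h'

/-- The geometric case in logarithmic form: `Φ_n(g) → ∑ k |g_k|²`. [folklore] -/
theorem tendsto_logSzego_of_geometric {g : ℝ → ℝ} (hc : Continuous g)
    (hp : Function.Periodic g (2 * Real.pi)) {C r : ℝ} (hr : 0 ≤ r) (hr1 : r < 1)
    (hcoeff : ∀ k, ‖circleCoeff (fun θ => (g θ : ℂ)) k‖ ≤ C * r ^ k.natAbs) :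
    Tendsto (fun n => logSzego n g) atTop (𝓝 (szegoSum g)) := by
  have h := tendsto_exp_logSzego_of_geometric hc hp hr hr1 hcoeff
  have h' := ((Real.continuousAt_log (Real.exp_pos (szegoSum g)).ne').tendsto).comp h
  simpa only [Function.comp_def, Real.log_exp] using h'

/-- **Monotonicity in `n` (geometric real symbols)**: `Φ_n(g)` increases to its limit, so
`Φ_n(g) ≤ ∑ k |g_k|²` for every `n` (log-concavity of `n ↦ D_n` and the limit). [folklore] -/
theorem logSzego_le_szegoSum_of_geometric {g : ℝ → ℝ} (hc : Continuous g)
    (hp : Function.Periodic g (2 * Real.pi)) {C r : ℝ} (hr : 0 ≤ r) (hr1 : r < 1)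
    (hcoeff : ∀ k, ‖circleCoeff (fun θ => (g θ : ℂ)) k‖ ≤ C * r ^ k.natAbs) (n : ℕ) :
    logSzego n g ≤ szegoSum g := by
  set L := szegoSum g with hL
  set ℓ : ℕ → ℝ := fun n => logSzego n g with hℓ
  have hlim : Tendsto ℓ atTop (𝓝 L) := tendsto_logSzego_of_geometric hc hp hr hr1 hcoeff
  -- concavity of `ℓ`
  have hconc : ∀ m, ℓ (m + 2) + ℓ m ≤ 2 * ℓ (m + 1) := by
    intro m
    simp only [hℓ, logSzego]
    have hsq := toeplitzDet_succ_succ_mul_le_sq (w := fun θ => Real.exp (g θ)) (by fun_prop)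
      (fun θ => Real.exp_pos _) m
    have h0 := toeplitzDet_exp_re_pos hc m
    have h1 := toeplitzDet_exp_re_pos hc (m + 1)
    have h2 := toeplitzDet_exp_re_pos hc (m + 2)
    have hlog := Real.log_le_log (mul_pos h2 h0) hsq
    rw [Real.log_mul h2.ne' h0.ne', Real.log_pow] at hlog
    push_cast at hlog ⊢
    nlinarith [hlog]
  set d : ℕ → ℝ := fun m => ℓ (m + 1) - ℓ m with hd
  have hanti : Antitone d := antitone_nat_of_succ_le fun m => by
    simp only [hd]
    have := hconc m
    linarith
  have hdlim : Tendsto d atTop (𝓝 0) := by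
    have h1 : Tendsto (fun m => ℓ (m + 1)) atTop (𝓝 L) := hlim.comp (tendsto_add_atTop_nat 1)
    have := h1.sub hlim
    rwa [sub_self] at this
  have hd0 : ∀ m, 0 ≤ d m := fun m => hanti.le_of_tendsto hdlim m
  have hmono : Monotone ℓ := monotone_nat_of_le_succ fun m => sub_nonneg.1 (hd0 m)
  exact hmono.ge_of_tendsto hlim n

/-- Real uniform convergence, seen in `ℂ`. [folklore] -/
theorem tendstoUniformly_ofReal {ι : Type*} {l : Filter ι} {G : ι → ℝ → ℝ} {g : ℝ → ℝ}
    (h : TendstoUniformly G g l) :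
    TendstoUniformly (fun i θ => (G i θ : ℂ)) (fun θ => (g θ : ℂ)) l := by
  rw [Metric.tendstoUniformly_iff] at h ⊢
  intro ε hε
  filter_upwards [h ε hε] with i hi θ
  rw [dist_eq_norm, ← Complex.ofReal_sub, Complex.norm_real, ← dist_eq_norm]
  exact hi θ

/-- The Fejér means of a bounded symbol have geometrically decaying (indeed finitely many)
Fourier coefficients: `|(σ_N h)_k| ≤ (B 2^N) (1/2)^{|k|}`. [folklore] -/
theorem norm_circleCoeff_fejerMean_le_geometric {h : ℝ → ℝ} (hc : Continuous h) {B : ℝ}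
    (hB : ∀ x, ‖h x‖ ≤ B) (N : ℕ) (k : ℤ) :
    ‖circleCoeff (fun θ => (fejerMean N h θ : ℂ)) k‖ ≤ B * 2 ^ N * (1 / 2 : ℝ) ^ k.natAbs := by
  have hB0 : 0 ≤ B := (norm_nonneg _).trans (hB 0)
  rcases le_or_gt k.natAbs N with hk | hk
  · have h1 := norm_circleCoeff_fejerMean_le hc N k
    have h2 : ‖circleCoeff (fun s => (h s : ℂ)) k‖ ≤ B :=
      norm_circleCoeff_le (fun θ => by rw [Complex.norm_real]; exact hB θ) k
    have h3 : (1 : ℝ) ≤ 2 ^ N * (1 / 2 : ℝ) ^ k.natAbs := by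
      calc (1 : ℝ) = 2 ^ k.natAbs * (1 / 2 : ℝ) ^ k.natAbs := by
            rw [← mul_pow]; norm_num
        _ ≤ 2 ^ N * (1 / 2 : ℝ) ^ k.natAbs := by
            gcongr
            · norm_num
    calc ‖circleCoeff (fun θ => (fejerMean N h θ : ℂ)) k‖ ≤ B := h1.trans h2
      _ = B * 1 := (mul_one B).symm
      _ ≤ B * (2 ^ N * (1 / 2 : ℝ) ^ k.natAbs) := by gcongr
      _ = B * 2 ^ N * (1 / 2 : ℝ) ^ k.natAbs := by ring
  · rw [circleCoeff_fejerMean_eq_zero hc N (by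
      rw [Int.abs_eq_natAbs]; exact_mod_cast hk), norm_zero]
    positivity

/-- **The strong Szegő limit theorem for real continuous symbols (logarithmic form)**:
`Φ_n(h) → ∑_{k≥1} k |h_k|²`, together with the uniform bound `Φ_n(h) ≤ ∑ k |h_k|²`. Proof:
Fejér approximation `σ_N h` (geometric case + monotonicity in `n` give `Φ_n(σ_N h) ≤ ∑ k |(σ_N h)_k|²
≤ ∑ k |h_k|²`, and `Φ_n(σ_N h) → Φ_n(h)`), and Jensen `Φ_n(h) ≥ Φ_n(σ_N h) → ∑ k|(σ_N h)_k|² → ∑ k|h_k|²`. [folklore] -/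
theorem logSzego_le_szegoSum {h : ℝ → ℝ} (hc : Continuous h)
    (hp : Function.Periodic h (2 * Real.pi))
    (hs : Summable fun k : ℕ => ((k : ℝ) + 1) * ‖circleCoeff (fun θ => (h θ : ℂ)) ((k : ℤ) + 1)‖ ^ 2)
    (n : ℕ) : logSzego n h ≤ szegoSum h := by
  obtain ⟨B, hB⟩ := exists_norm_le_of_periodic hc hp
  have hσc := fun N => continuous_fejerMean hc N
  have hσp := fun N => fejerMean_periodic hc N
  have hgeo := fun N => norm_circleCoeff_fejerMean_le_geometric hc hB N
  have half_lt : (1 / 2 : ℝ) < 1 := by norm_num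
  have half_nn : (0 : ℝ) ≤ 1 / 2 := by norm_num
  -- `Φ_n(σ_N h) ≤ ∑ k |(σ_N h)_k|² ≤ ∑ k |h_k|²`
  have hle : ∀ N, logSzego n (fejerMean N h) ≤ szegoSum h := by
    intro N
    refine (logSzego_le_szegoSum_of_geometric (hσc N) (hσp N) half_nn half_lt (hgeo N) n).trans ?_
    unfold szegoSum
    refine Summable.tsum_le_tsum (fun k => ?_) ?_ hs
    · gcongr
      exact norm_circleCoeff_fejerMean_le hc N _
    · exact Summable.of_nonneg_of_le (fun k => by positivity)
        (fun k => by gcongr; exact norm_circleCoeff_fejerMean_le hc N _) hs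
  have hlim := tendsto_logSzego n hσc hc ⟨B, fun x => by have := hB x; rwa [Real.norm_eq_abs] at this⟩
    (tendstoUniformly_fejerMean hc hp)
  exact le_of_tendsto' hlim hle

/-- The Szegő sums of the Fejér means converge: `∑ k |(σ_N h)_k|² → ∑ k |h_k|²`. [folklore] -/
theorem tendsto_szegoSum_fejerMean {h : ℝ → ℝ} (hc : Continuous h)
    (hp : Function.Periodic h (2 * Real.pi))
    (hs : Summable fun k : ℕ => ((k : ℝ) + 1) * ‖circleCoeff (fun θ => (h θ : ℂ)) ((k : ℤ) + 1)‖ ^ 2) :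
    Tendsto (fun N => szegoSum (fejerMean N h)) atTop (𝓝 (szegoSum h)) := by
  unfold szegoSum
  refine tendsto_tsum_of_dominated_convergence hs (fun k => ?_)
    (Eventually.of_forall fun N k => ?_)
  · have hcoef := tendsto_circleCoeff_of_tendstoUniformly
      (fun N => Complex.continuous_ofReal.comp (continuous_fejerMean hc N))
      (Complex.continuous_ofReal.comp hc)
      (tendstoUniformly_ofReal (tendstoUniformly_fejerMean hc hp)) ((k : ℤ) + 1)
    exact ((continuous_const.mul ((continuous_norm.comp continuous_id).pow 2)).tendsto _).comp hcoef
  · rw [Real.norm_of_nonneg (by positivity)]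
    gcongr
    exact norm_circleCoeff_fejerMean_le hc N _

/-- **The strong Szegő limit theorem for real continuous symbols**: `Φ_n(h) → ∑_{k≥1} k |h_k|²`. [folklore] -/
theorem tendsto_logSzego_szegoSum {h : ℝ → ℝ} (hc : Continuous h)
    (hp : Function.Periodic h (2 * Real.pi))
    (hs : Summable fun k : ℕ => ((k : ℝ) + 1) * ‖circleCoeff (fun θ => (h θ : ℂ)) ((k : ℤ) + 1)‖ ^ 2) :
    Tendsto (fun n => logSzego n h) atTop (𝓝 (szegoSum h)) := by
  obtain ⟨B, hB⟩ := exists_norm_le_of_periodic hc hp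
  have hσc := fun N => continuous_fejerMean hc N
  have hσp := fun N => fejerMean_periodic hc N
  have hgeo := fun N => norm_circleCoeff_fejerMean_le_geometric hc hB N
  have half_lt : (1 / 2 : ℝ) < 1 := by norm_num
  have half_nn : (0 : ℝ) ≤ 1 / 2 := by norm_num
  have hup := logSzego_le_szegoSum hc hp hs
  have hS := tendsto_szegoSum_fejerMean hc hp hs
  rw [Metric.tendsto_nhds]
  intro ε hε
  -- choose `N` with `∑ k |(σ_N h)_k|² > ∑ k |h_k|² - ε/2`
  obtain ⟨N, hN⟩ := ((Metric.tendsto_nhds.1 hS) (ε / 2) (half_pos hε)).exists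
  -- `Φ_n(σ_N h) → ∑ k |(σ_N h)_k|²`
  have hG := tendsto_logSzego_of_geometric (hσc N) (hσp N) half_nn half_lt (hgeo N)
  filter_upwards [(Metric.tendsto_nhds.1 hG) (ε / 2) (half_pos hε)] with n hn
  have hJ := logSzego_fejerMean_le n N hc hp
  rw [Real.dist_eq, abs_lt] at hN hn ⊢
  constructor <;> linarith [hup n]

/-- **The strong Szegő limit theorem for real continuous symbols**:
`D_n(e^h)/e^{n h_0} → exp(∑_{k≥1} k |h_k|²)`. [folklore] -/
theorem tendsto_exp_logSzego {h : ℝ → ℝ} (hc : Continuous h) (hp : Function.Periodic h (2 * Real.pi))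
    (hs : Summable fun k : ℕ => ((k : ℝ) + 1) * ‖circleCoeff (fun θ => (h θ : ℂ)) ((k : ℤ) + 1)‖ ^ 2) :
    Tendsto (fun n => Real.exp (logSzego n h)) atTop (𝓝 (Real.exp (szegoSum h))) :=
  (Real.continuous_exp.tendsto _).comp (tendsto_logSzego_szegoSum hc hp hs)

end RealCase

/-! ### The complex case: analytic interpolation in the symbol -/

section ComplexCase

/-- The **Szegő quotient** `F_n(V) = D_n(e^V) / e^{n V_0}`. [folklore] -/
def szegoQuot (V : ℝ → ℂ) (n : ℕ) : ℂ :=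
  toeplitzDet (circleCoeff fun θ => Complex.exp (V θ)) n / Complex.exp (n * circleCoeff V 0)

/-- The affine family of symbols `W_z = A + z B` through two real symbols. [folklore] -/
def affSymbol (A B : ℝ → ℝ) (z : ℂ) (θ : ℝ) : ℂ := (A θ : ℂ) + z * (B θ : ℂ)

variable {A B : ℝ → ℝ}

/-- The affine symbols are continuous. [folklore] -/
theorem continuous_affSymbol (hA : Continuous A) (hB : Continuous B) (z : ℂ) :
    Continuous (affSymbol A B z) := by unfold affSymbol; fun_prop

/-- At a real parameter the affine symbol is the real symbol `A + tB`. [folklore] -/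
theorem affSymbol_ofReal (A B : ℝ → ℝ) (t : ℝ) :
    affSymbol A B t = fun θ => ((A θ + t * B θ : ℝ) : ℂ) := by
  funext θ; unfold affSymbol; push_cast; ring

/-- Linearity: `(W_z)_k = A_k + z B_k`. [folklore] -/
theorem circleCoeff_affSymbol (hA : Continuous A) (hB : Continuous B) (z : ℂ) (k : ℤ) :
    circleCoeff (affSymbol A B z) k =
      circleCoeff (fun θ => (A θ : ℂ)) k + z * circleCoeff (fun θ => (B θ : ℂ)) k := by
  unfold affSymbol
  rw [circleCoeff_add (by fun_prop) (by fun_prop), circleCoeff_const_mul]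

/-- **Holomorphy of the coefficients** `z ↦ (e^{W_z})_m` (differentiation under the integral). [folklore] -/
theorem differentiable_circleCoeff_exp_affSymbol (hA : Continuous A) (hB : Continuous B) (m : ℤ) :
    Differentiable ℂ fun z => circleCoeff (fun θ => Complex.exp (affSymbol A B z θ)) m := by
  intro z₀
  -- bounds for `A`, `B` on `[-π, π]`
  obtain ⟨CA, hCA⟩ := (isCompact_Icc : IsCompact (Set.Icc (-Real.pi) Real.pi)).exists_bound_of_continuousOn
    hA.continuousOn
  obtain ⟨CB, hCB⟩ := (isCompact_Icc : IsCompact (Set.Icc (-Real.pi) Real.pi)).exists_bound_of_continuousOn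
    hB.continuousOn
  set F : ℂ → ℝ → ℂ := fun z θ => Complex.exp (-(m * θ * I)) * Complex.exp (affSymbol A B z θ) with hF
  set F' : ℂ → ℝ → ℂ := fun z θ =>
    Complex.exp (-(m * θ * I)) * (Complex.exp (affSymbol A B z θ) * (B θ : ℂ)) with hF'
  have hFc : ∀ z, Continuous (F z) := fun z => by
    have := continuous_affSymbol hA hB z; simp only [hF]; fun_prop
  have hF'c : ∀ z, Continuous (F' z) := fun z => by
    have := continuous_affSymbol hA hB z; simp only [hF']; fun_prop
  set bnd : ℝ := Real.exp (CA + (‖z₀‖ + 1) * CB) * CB with hbnd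
  have hderiv : ∀ θ z, HasDerivAt (fun z => F z θ) (F' z θ) z := by
    intro θ z
    simp only [hF, hF', affSymbol]
    have h1 : HasDerivAt (fun z : ℂ => (A θ : ℂ) + z * (B θ : ℂ)) (B θ : ℂ) z := by
      simpa using ((hasDerivAt_id z).mul_const (B θ : ℂ)).const_add (A θ : ℂ)
    have h2 := (Complex.hasDerivAt_exp _).comp z h1
    exact h2.const_mul _
  have key := intervalIntegral.hasDerivAt_integral_of_dominated_loc_of_deriv_le
    (μ := volume) (a := -Real.pi) (b := Real.pi) (F := F) (F' := F') (x₀ := z₀)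
    (s := Metric.ball z₀ 1) (bound := fun _ => bnd) (Metric.ball_mem_nhds z₀ one_pos)
    (Eventually.of_forall fun z => (hFc z).aestronglyMeasurable)
    ((hFc z₀).intervalIntegrable _ _) ((hF'c z₀).aestronglyMeasurable)
    (Eventually.of_forall fun θ hθ z hz => ?_) intervalIntegrable_const
    (Eventually.of_forall fun θ _ z _ => hderiv θ z)
  · have hd := key.2.differentiableAt
    have heq : (fun z => circleCoeff (fun θ => Complex.exp (affSymbol A B z θ)) m) =
        fun z => (2 * Real.pi : ℂ)⁻¹ * ∫ θ in (-Real.pi)..Real.pi, F z θ := by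
      funext z; rfl
    rw [heq]
    exact hd.const_mul _
  · -- the uniform bound on the derivative
    have hθ' : θ ∈ Set.Icc (-Real.pi) Real.pi := by
      rw [Set.uIoc_of_le (by linarith [Real.pi_pos])] at hθ
      exact Set.Ioc_subset_Icc_self hθ
    have hAθ : |A θ| ≤ CA := by simpa [Real.norm_eq_abs] using hCA θ hθ'
    have hBθ : |B θ| ≤ CB := by simpa [Real.norm_eq_abs] using hCB θ hθ'
    have hz' : ‖z‖ ≤ ‖z₀‖ + 1 := by
      have := Metric.mem_ball.1 hz
      rw [dist_eq_norm] at this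
      linarith [norm_sub_norm_le z z₀]
    simp only [hF', norm_mul]
    rw [show -((m : ℂ) * θ * I) = ((-(m * θ) : ℝ) : ℂ) * I by push_cast; ring,
      Complex.norm_exp_ofReal_mul_I, one_mul, Complex.norm_exp, Complex.norm_real]
    have hre : (affSymbol A B z θ).re ≤ CA + (‖z₀‖ + 1) * CB := by
      simp only [affSymbol, Complex.add_re, Complex.ofReal_re, Complex.mul_re, Complex.ofReal_im,
        mul_zero, sub_zero]
      have h1 : A θ ≤ CA := (le_abs_self _).trans hAθ
      have h2 : z.re * B θ ≤ (‖z₀‖ + 1) * CB := by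
        calc z.re * B θ ≤ |z.re * B θ| := le_abs_self _
          _ = |z.re| * |B θ| := abs_mul _ _
          _ ≤ (‖z₀‖ + 1) * CB := mul_le_mul ((Complex.abs_re_le_norm z).trans hz') hBθ
              (abs_nonneg _) (by positivity)
      linarith
    rw [hbnd, Real.norm_eq_abs]
    exact mul_le_mul (Real.exp_le_exp.2 hre) hBθ (abs_nonneg _) (Real.exp_pos _).le

/-- Holomorphy of `z ↦ D_n(e^{W_z})`. [folklore] -/
theorem differentiable_toeplitzDet_exp_affSymbol (hA : Continuous A) (hB : Continuous B) (n : ℕ) :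
    Differentiable ℂ fun z =>
      toeplitzDet (circleCoeff fun θ => Complex.exp (affSymbol A B z θ)) n := by
  unfold toeplitzDet
  simp_rw [det_apply']
  refine Differentiable.fun_sum fun σ _ => ?_
  refine (Differentiable.fun_finsetProd fun i _ => ?_).const_mul _
  simp only [toeplitzMatrix_apply]
  exact differentiable_circleCoeff_exp_affSymbol hA hB _

/-- Holomorphy of the Szegő quotient `z ↦ F_n(W_z)`. [folklore] -/
theorem differentiable_szegoQuot_affSymbol (hA : Continuous A) (hB : Continuous B) (n : ℕ) :
    Differentiable ℂ fun z => szegoQuot (affSymbol A B z) n := by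
  unfold szegoQuot
  refine (differentiable_toeplitzDet_exp_affSymbol hA hB n).div ?_ fun z => Complex.exp_ne_zero _
  simp_rw [circleCoeff_affSymbol hA hB]
  fun_prop

/-- On the real axis the family consists of real symbols: `F_n(W_t) = exp Φ_n(A + tB)`. [folklore] -/
theorem szegoQuot_affSymbol_ofReal (hA : Continuous A) (hB : Continuous B) (t : ℝ) (n : ℕ) :
    szegoQuot (affSymbol A B t) n = ((Real.exp (logSzego n fun θ => A θ + t * B θ) : ℝ) : ℂ) := by
  rw [szegoQuot, affSymbol_ofReal]
  exact szegoQuot_ofReal (by fun_prop) n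

/-- **A priori bound**: `|F_n(W_z)| ≤ exp Φ_n(A + (Re z) B)` (`|D_n(f)| ≤ D_n(|f|)`). [folklore] -/
theorem norm_szegoQuot_affSymbol_le (hA : Continuous A) (hB : Continuous B) (z : ℂ) (n : ℕ) :
    ‖szegoQuot (affSymbol A B z) n‖ ≤ Real.exp (logSzego n fun θ => A θ + z.re * B θ) := by
  set g : ℝ → ℝ := fun θ => A θ + z.re * B θ with hg
  have hgc : Continuous g := by rw [hg]; fun_prop
  have hnum := norm_toeplitzDet_le (f := fun θ => Complex.exp (affSymbol A B z θ))
    (by have := continuous_affSymbol hA hB z; fun_prop) n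
  have hmod : (fun θ => (‖Complex.exp (affSymbol A B z θ)‖ : ℂ)) = fun θ => ((Real.exp (g θ) : ℝ) : ℂ) := by
    funext θ
    rw [Complex.norm_exp]
    simp [affSymbol, hg]
  rw [hmod] at hnum
  have hden : ‖Complex.exp (n * circleCoeff (affSymbol A B z) 0)‖ = Real.exp (n * symbolMean g) := by
    rw [Complex.norm_exp, circleCoeff_affSymbol hA hB, circleCoeff_ofReal_zero, circleCoeff_ofReal_zero]
    congr 1
    have : symbolMean g = symbolMean A + z.re * symbolMean B := by
      rw [hg]; simpa using symbolMean_add hA hB 1 z.re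
    rw [this]
    simp
  rw [szegoQuot, norm_div, hden, logSzego, Real.exp_sub, Real.exp_log (toeplitzDet_exp_re_pos hgc n)]
  exact div_le_div_of_nonneg_right hnum (Real.exp_pos _).le

/-! #### An abstract two-constants lemma: entire families bounded in horizontal strips -/

/-- Pointwise convergence on the real axis of a uniformly Lipschitz family is uniform on
compact intervals. [folklore] -/
theorem eventually_forall_norm_sub_one_le {H : ℕ → ℂ → ℂ} {L : ℝ} (hL : 0 ≤ L)
    (hlip : ∀ n (t s : ℝ), ‖H n t - H n s‖ ≤ L * |t - s|)
    (hreal : ∀ t : ℝ, Tendsto (fun n => H n t) atTop (𝓝 1)) {T ρ : ℝ} (_hT : 0 < T)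
    (hρ : 0 < ρ) : ∀ᶠ n in atTop, ∀ t : ℝ, |t| ≤ T → ‖H n t - 1‖ ≤ ρ := by
  set δ₀ : ℝ := ρ / (2 * (L + 1)) with hδ₀
  have hδ₀pos : 0 < δ₀ := by positivity
  set N₁ : ℕ := ⌈T / δ₀⌉₊ + 1 with hN₁
  set S : Finset ℤ := Finset.Icc (-(N₁ : ℤ)) N₁ with hS
  have h1 : ∀ᶠ n in atTop, ∀ j ∈ S, ‖H n ((j : ℝ) * δ₀ : ℝ) - 1‖ < ρ / 2 := by
    rw [Filter.eventually_all_finset]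
    intro j _
    have := Metric.tendsto_nhds.1 (hreal ((j : ℝ) * δ₀)) (ρ / 2) (half_pos hρ)
    simpa only [dist_eq_norm] using this
  filter_upwards [h1] with n hn t ht
  set j : ℤ := ⌊t / δ₀⌋ with hj
  have hj1 : (j : ℝ) ≤ t / δ₀ := Int.floor_le _
  have hj2 : t / δ₀ < j + 1 := Int.lt_floor_add_one _
  have hjt : |t - (j : ℝ) * δ₀| ≤ δ₀ := by
    rw [abs_le]
    rw [le_div_iff₀ hδ₀pos] at hj1
    rw [div_lt_iff₀ hδ₀pos] at hj2
    constructor <;> nlinarith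
  have habs := abs_le.1 ht
  have hTδ : T / δ₀ ≤ ⌈T / δ₀⌉₊ := Nat.le_ceil _
  have hjS : j ∈ S := by
    rw [hS, Finset.mem_Icc]
    have hN₁r : ((N₁ : ℤ) : ℝ) = ⌈T / δ₀⌉₊ + 1 := by rw [hN₁]; push_cast; ring
    constructor
    · have h3 : -T / δ₀ ≤ t / δ₀ := by gcongr; exact habs.1
      rw [neg_div] at h3
      have : -(((N₁ : ℤ) : ℝ)) ≤ j := by rw [hN₁r]; linarith
      exact_mod_cast this
    · have : (j : ℝ) ≤ (N₁ : ℤ) := by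
        rw [hN₁r]
        have h3 : t / δ₀ ≤ T / δ₀ := by gcongr; exact habs.2
        linarith
      exact_mod_cast this
  have hnode := hn j hjS
  calc ‖H n t - 1‖ ≤ ‖H n t - H n ((j : ℝ) * δ₀ : ℝ)‖ + ‖H n ((j : ℝ) * δ₀ : ℝ) - 1‖ :=
        norm_sub_le_norm_sub_add_norm_sub _ _ _
    _ ≤ L * δ₀ + ρ / 2 := add_le_add ((hlip n _ _).trans (by gcongr)) hnode.le
    _ ≤ ρ / 2 + ρ / 2 := by
        gcongr
        rw [hδ₀, mul_div_assoc', div_le_div_iff₀ (by positivity) two_pos]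
        nlinarith
    _ = ρ := by ring

/-- **Two-constants lemma for horizontal strips**: an entire family with `|H_n(x+iy)| ≤ e^{β y²}`
converging to `1` pointwise on the real axis converges to `1` at `i` (maximum modulus on a
rectangle for `(H_n - 1) e^{-z²} e^{iKz}`). [folklore] -/
theorem tendsto_atI_of_strip_bound {H : ℕ → ℂ → ℂ} (hd : ∀ n, Differentiable ℂ (H n)) {β : ℝ}
    (hβ : 0 ≤ β) (hb : ∀ n z, ‖H n z‖ ≤ Real.exp (β * z.im ^ 2))
    (hreal : ∀ t : ℝ, Tendsto (fun n => H n t) atTop (𝓝 1)) :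
    Tendsto (fun n => H n I) atTop (𝓝 1) := by
  rw [Metric.tendsto_nhds]
  intro η₀ hη₀
  -- WLOG `η ≤ 1`
  set η : ℝ := min η₀ 1 with hηdef
  have hη : 0 < η := lt_min hη₀ one_pos
  have hη1 : η ≤ 1 := min_le_right _ _
  suffices h : ∀ᶠ n in atTop, ‖H n I - 1‖ < η by
    filter_upwards [h] with n hn
    rw [dist_eq_norm]; exact lt_of_lt_of_le hn (min_le_left _ _)
  -- constants
  set M : ℝ := Real.exp (4 * β) + 1 with hM
  have hM1 : 1 ≤ M := by have := Real.exp_pos (4 * β); linarith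
  have hM0 : 0 < M := by linarith
  have hHM : ∀ n z, 0 ≤ z.im → z.im ≤ 2 → ‖H n z - 1‖ ≤ M := by
    intro n z h0 h2
    calc ‖H n z - 1‖ ≤ ‖H n z‖ + ‖(1 : ℂ)‖ := norm_sub_le _ _
      _ ≤ Real.exp (β * z.im ^ 2) + 1 := by rw [norm_one]; gcongr; exact hb n z
      _ ≤ M := by
          rw [hM]
          have hle : β * z.im ^ 2 ≤ 4 * β := by
            calc β * z.im ^ 2 ≤ β * 4 := mul_le_mul_of_nonneg_left (by nlinarith) hβ
              _ = 4 * β := by ring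
          linarith [Real.exp_le_exp.2 hle]
  set K : ℝ := 4 - Real.log (η / (2 * M)) with hK
  have hlogneg : Real.log (η / (2 * M)) ≤ 0 :=
    Real.log_nonpos (by positivity) (by rw [div_le_one (by positivity)]; linarith)
  have hK4 : 4 ≤ K := by linarith
  have hK0 : 0 ≤ K := by linarith
  have hexpK : Real.exp (3 - K) < η / (2 * M) := by
    rw [hK, show 3 - (4 - Real.log (η / (2 * M))) = -1 + Real.log (η / (2 * M)) by ring,
      Real.exp_add, Real.exp_log (by positivity)]
    have : Real.exp (-1) < 1 := by rw [Real.exp_lt_one_iff]; norm_num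
    calc Real.exp (-1) * (η / (2 * M)) < 1 * (η / (2 * M)) := by gcongr
      _ = η / (2 * M) := one_mul _
  set T : ℝ := K + 4 - Real.log (η / (2 * M)) with hT
  have hT1 : 1 ≤ T := by linarith
  have hT0 : 0 < T := by linarith
  have hexpT : Real.exp (K + 3 - T ^ 2) < η / (2 * M) := by
    have hT2 : T ≤ T ^ 2 := by nlinarith
    calc Real.exp (K + 3 - T ^ 2) ≤ Real.exp (K + 3 - T) := Real.exp_le_exp.2 (by linarith)
      _ = Real.exp (-1) * (η / (2 * M)) := by
          rw [hT, show K + 3 - (K + 4 - Real.log (η / (2 * M))) = -1 + Real.log (η / (2 * M)) by ring,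
            Real.exp_add, Real.exp_log (by positivity)]
      _ < 1 * (η / (2 * M)) := by gcongr; rw [Real.exp_lt_one_iff]; norm_num
      _ = η / (2 * M) := one_mul _
  set ρ : ℝ := η / 2 * Real.exp (1 - K) with hρ
  have hρ0 : 0 < ρ := by positivity
  -- Lipschitz bound on the real axis via the Cauchy estimate
  set L : ℝ := Real.exp β with hL
  have hderiv : ∀ n (t : ℝ), ‖deriv (H n) t‖ ≤ L := by
    intro n t
    have h := Complex.norm_deriv_le_of_forall_mem_sphere_norm_le (f := H n) (c := (t : ℂ)) (R := 1)
      (C := L) one_pos ((hd n).diffContOnCl) fun z hz => ?_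
    · simpa using h
    · rw [mem_sphere_iff_norm] at hz
      have him : |z.im| ≤ 1 := by
        have := Complex.abs_im_le_norm (z - t)
        rw [hz] at this
        simpa using this
      calc ‖H n z‖ ≤ Real.exp (β * z.im ^ 2) := hb n z
        _ ≤ Real.exp β := by
            refine Real.exp_le_exp.2 ?_
            have hsq : z.im ^ 2 ≤ 1 := by rw [← sq_abs]; nlinarith [abs_nonneg z.im]
            calc β * z.im ^ 2 ≤ β * 1 := mul_le_mul_of_nonneg_left hsq hβ
              _ = β := mul_one β
  have hconv : Convex ℝ {z : ℂ | z.im = 0} := by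
    intro x hx y hy a b _ _ _
    simp only [Set.mem_setOf_eq] at hx hy ⊢
    simp [hx, hy]
  have hlip : ∀ n (t s : ℝ), ‖H n t - H n s‖ ≤ L * |t - s| := by
    intro n t s
    have h := hconv.norm_image_sub_le_of_norm_deriv_le (𝕜 := ℂ) (f := H n) (C := L)
      (fun x _ => (hd n x)) (fun x hx => ?_) (x := (s : ℂ)) (y := (t : ℂ)) (by simp) (by simp)
    · rw [← Complex.ofReal_sub, Complex.norm_real, Real.norm_eq_abs] at h
      exact h
    · have hx' : x = ((x.re : ℝ) : ℂ) := Complex.ext rfl (by simpa using hx)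
      rw [hx']
      exact hderiv n x.re
  -- uniform smallness on `[-T, T]`, eventually
  have hbottom := eventually_forall_norm_sub_one_le (Real.exp_pos β).le hlip hreal hT0 hρ0
  filter_upwards [hbottom] with n hn
  -- the auxiliary function and the rectangle
  set w : ℂ → ℂ := fun ζ => Complex.exp (-ζ ^ 2 + I * K * ζ) with hw
  have hw_norm : ∀ ζ, ‖w ζ‖ = Real.exp (ζ.im ^ 2 - ζ.re ^ 2 - K * ζ.im) := by
    intro ζ
    rw [hw]
    simp only [Complex.norm_exp]
    congr 1
    simp only [Complex.add_re, Complex.neg_re, Complex.mul_re, Complex.mul_im, Complex.I_re,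
      Complex.I_im, sq, Complex.ofReal_re, Complex.ofReal_im]
    ring
  set φ : ℂ → ℂ := fun ζ => (H n ζ - 1) * w ζ with hφ
  have hφd : Differentiable ℂ φ := by
    simp only [hφ, hw]
    exact ((hd n).sub_const 1).mul (by fun_prop)
  set U : Set ℂ := (Set.Ioo (-T) T) ×ℂ (Set.Ioo 0 2) with hU
  have hUb : Bornology.IsBounded U := (Metric.isBounded_Ioo _ _).reProdIm (Metric.isBounded_Ioo _ _)
  set C : ℝ := max ρ (max (M * Real.exp (4 - 2 * K)) (M * Real.exp (4 - T ^ 2))) with hC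
  have hfront : ∀ ζ ∈ frontier U, ‖φ ζ‖ ≤ C := by
    intro ζ hζ
    rw [hU, frontier_reProdIm, closure_Ioo (by linarith), frontier_Ioo (by norm_num),
      closure_Ioo (by norm_num), frontier_Ioo (by linarith)] at hζ
    simp only [hφ, norm_mul, hw_norm]
    rcases hζ with h | h
    · -- bottom or top edge
      obtain ⟨hre, him⟩ := mem_reProdIm.1 h
      rw [Set.mem_Icc] at hre
      rcases him with him | him
      · -- bottom: `ζ` real, `|ζ| ≤ T`
        have hζ : ζ = ((ζ.re : ℝ) : ℂ) := Complex.ext rfl (by simpa using him)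
        have h1 : ‖H n ζ - 1‖ ≤ ρ := by rw [hζ]; exact hn ζ.re (abs_le.2 hre)
        calc ‖H n ζ - 1‖ * Real.exp (ζ.im ^ 2 - ζ.re ^ 2 - K * ζ.im) ≤ ρ * 1 := by
              refine mul_le_mul h1 ?_ (Real.exp_pos _).le hρ0.le
              rw [him, Real.exp_le_one_iff]; nlinarith
          _ ≤ C := by rw [mul_one]; exact le_max_left _ _
      · -- top edge `im ζ = 2`
        rw [Set.mem_singleton_iff] at him
        calc ‖H n ζ - 1‖ * Real.exp (ζ.im ^ 2 - ζ.re ^ 2 - K * ζ.im)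
            ≤ M * Real.exp (4 - 2 * K) := by
              refine mul_le_mul (hHM n ζ (by rw [him]; norm_num) (by rw [him])) ?_
                (Real.exp_pos _).le hM0.le
              rw [him, Real.exp_le_exp]; nlinarith
          _ ≤ C := le_trans (le_max_left _ _) (le_max_right _ _)
    · -- side edges `re ζ = ±T`
      obtain ⟨hre, him⟩ := mem_reProdIm.1 h
      rw [Set.mem_Icc] at him
      have hre2 : ζ.re ^ 2 = T ^ 2 := by
        rcases hre with h | h
        · rw [h]; ring
        · rw [Set.mem_singleton_iff] at h; rw [h]
      calc ‖H n ζ - 1‖ * Real.exp (ζ.im ^ 2 - ζ.re ^ 2 - K * ζ.im)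
          ≤ M * Real.exp (4 - T ^ 2) := by
            refine mul_le_mul (hHM n ζ him.1 him.2) ?_ (Real.exp_pos _).le hM0.le
            rw [hre2, Real.exp_le_exp]; nlinarith
        _ ≤ C := le_trans (le_max_right _ _) (le_max_right _ _)
  have hIU : I ∈ closure U := subset_closure (by
    rw [hU, mem_reProdIm]; exact ⟨by simp; exact hT0, by simp⟩)
  have hmax := Complex.norm_le_of_forall_mem_frontier_norm_le hUb hφd.diffContOnCl hfront hIU
  -- unwind at `ζ = I`
  have hφI : ‖φ I‖ = ‖H n I - 1‖ * Real.exp (1 - K) := by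
    simp only [hφ, norm_mul, hw_norm, Complex.I_im, Complex.I_re]
    congr 1; congr 1; ring
  rw [hφI] at hmax
  have hfinal : ‖H n I - 1‖ ≤ C * Real.exp (K - 1) := by
    have := mul_le_mul_of_nonneg_right hmax (Real.exp_pos (K - 1)).le
    rwa [mul_assoc, ← Real.exp_add, show 1 - K + (K - 1) = 0 by ring, Real.exp_zero, mul_one] at this
  refine lt_of_le_of_lt hfinal ?_
  -- each of the three constants is `< η` after multiplication by `e^{K-1}`
  rw [hC, max_mul_of_nonneg _ _ (Real.exp_pos _).le, max_mul_of_nonneg _ _ (Real.exp_pos _).le,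
    max_lt_iff, max_lt_iff]
  refine ⟨?_, ?_, ?_⟩
  · rw [hρ, mul_assoc, ← Real.exp_add, show 1 - K + (K - 1) = 0 by ring, Real.exp_zero, mul_one]
    linarith
  · rw [mul_assoc, ← Real.exp_add, show 4 - 2 * K + (K - 1) = 3 - K by ring]
    calc M * Real.exp (3 - K) < M * (η / (2 * M)) := by gcongr
      _ = η / 2 := by field_simp
      _ < η := half_lt_self hη
  · rw [mul_assoc, ← Real.exp_add, show 4 - T ^ 2 + (K - 1) = K + 3 - T ^ 2 by ring]
    calc M * Real.exp (K + 3 - T ^ 2) < M * (η / (2 * M)) := by gcongr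
      _ = η / 2 := by field_simp
      _ < η := half_lt_self hη

/-! #### Real and imaginary parts of a complex symbol -/

/-- `(Re V)_m = (V_m + conj V_{-m}) / 2`. [folklore] -/
theorem circleCoeff_re_part {V : ℝ → ℂ} (hV : Continuous V) (m : ℤ) :
    circleCoeff (fun θ => ((V θ).re : ℂ)) m = (circleCoeff V m + conj (circleCoeff V (-m))) / 2 := by
  have hfun : (fun θ => ((V θ).re : ℂ)) = fun θ => (1 / 2 : ℂ) * (V θ + conj (V θ)) := by
    funext θ; rw [Complex.re_eq_add_conj]; ring
  have hc : circleCoeff (fun θ => conj (V θ)) m = conj (circleCoeff V (-m)) := by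
    rw [conj_circleCoeff, neg_neg]
  rw [hfun, circleCoeff_const_mul, circleCoeff_add (g := fun θ => conj (V θ)) hV
    (Complex.continuous_conj.comp hV), hc]
  ring

/-- `(Im V)_m = (V_m - conj V_{-m}) / (2i)`. [folklore] -/
theorem circleCoeff_im_part {V : ℝ → ℂ} (hV : Continuous V) (m : ℤ) :
    circleCoeff (fun θ => ((V θ).im : ℂ)) m = (circleCoeff V m - conj (circleCoeff V (-m))) / (2 * I) := by
  have hfun : (fun θ => ((V θ).im : ℂ)) = fun θ => (1 / (2 * I) : ℂ) * (V θ - conj (V θ)) := by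
    funext θ; rw [Complex.im_eq_sub_conj]; ring
  have hc : circleCoeff (fun θ => conj (V θ)) m = conj (circleCoeff V (-m)) := by
    rw [conj_circleCoeff, neg_neg]
  rw [hfun, circleCoeff_const_mul, circleCoeff_sub (g := fun θ => conj (V θ)) hV
    (Complex.continuous_conj.comp hV), hc]
  ring

/-- `|(Re V)_m| ≤ (|V_m| + |V_{-m}|)/2`. [folklore] -/
theorem norm_circleCoeff_re_part_le {V : ℝ → ℂ} (hV : Continuous V) (m : ℤ) :
    ‖circleCoeff (fun θ => ((V θ).re : ℂ)) m‖ ≤ (‖circleCoeff V m‖ + ‖circleCoeff V (-m)‖) / 2 := by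
  rw [circleCoeff_re_part hV, norm_div, Complex.norm_two]
  gcongr
  exact (norm_add_le _ _).trans (by rw [Complex.norm_conj])

/-- `|(Im V)_m| ≤ (|V_m| + |V_{-m}|)/2`. [folklore] -/
theorem norm_circleCoeff_im_part_le {V : ℝ → ℂ} (hV : Continuous V) (m : ℤ) :
    ‖circleCoeff (fun θ => ((V θ).im : ℂ)) m‖ ≤ (‖circleCoeff V m‖ + ‖circleCoeff V (-m)‖) / 2 := by
  rw [circleCoeff_im_part hV, norm_div, norm_mul, Complex.norm_two, Complex.norm_I, mul_one]
  gcongr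
  exact (norm_sub_le _ _).trans (by rw [Complex.norm_conj])

/-- The elementary identity behind the strip bound:
`Re[r (a + zb)(ā + z b̄)] = r (|a + (Re z) b|² - (Im z)² |b|²)`. [folklore] -/
theorem re_weighted_term (a b z : ℂ) (r : ℝ) :
    ((r : ℂ) * (a + z * b) * (conj a + z * conj b)).re =
      r * (‖a + z.re * b‖ ^ 2 - z.im ^ 2 * ‖b‖ ^ 2) := by
  simp only [Complex.sq_norm, Complex.normSq_apply, Complex.mul_re, Complex.mul_im, Complex.add_re,
    Complex.add_im, Complex.conj_re, Complex.conj_im, Complex.ofReal_re, Complex.ofReal_im]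
  ring

/-- From `∑_{k∈ℤ} |k| |V_k|² < ∞` to the one-sided weighted square-summability of `V_{±k}`. [folklore] -/
theorem summable_pos_neg_of_summable_abs {V : ℝ → ℂ}
    (hs : Summable fun k : ℤ => (|k| : ℝ) * ‖circleCoeff V k‖ ^ 2) :
    (Summable fun k : ℕ => ((k : ℝ) + 1) * ‖circleCoeff V ((k : ℤ) + 1)‖ ^ 2) ∧
      Summable fun k : ℕ => ((k : ℝ) + 1) * ‖circleCoeff V (-((k : ℤ) + 1))‖ ^ 2 := by
  constructor
  · have h := hs.comp_injective (i := fun k : ℕ => (k : ℤ) + 1) fun a b hab => by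
      simpa using hab
    refine h.congr fun k => ?_
    simp only [Function.comp_apply]
    push_cast
    rw [abs_of_nonneg (by positivity)]
  · have h := hs.comp_injective (i := fun k : ℕ => -((k : ℤ) + 1)) fun a b hab => by
      simpa using hab
    refine h.congr fun k => ?_
    simp only [Function.comp_apply]
    push_cast
    rw [abs_neg, abs_of_nonneg (by positivity)]

/-- Weighted square-summability of a coefficient sequence dominated by `(|V_m| + |V_{-m}|)/2`. [folklore] -/
theorem summable_weighted_sq_of_le {V : ℝ → ℂ} {c : ℤ → ℂ}
    (hs : Summable fun k : ℤ => (|k| : ℝ) * ‖circleCoeff V k‖ ^ 2)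
    (hc : ∀ m, ‖c m‖ ≤ (‖circleCoeff V m‖ + ‖circleCoeff V (-m)‖) / 2) (x : ℝ) :
    Summable fun k : ℕ => ((k : ℝ) + 1) * (x * ‖c ((k : ℤ) + 1)‖) ^ 2 := by
  obtain ⟨h1, h2⟩ := summable_pos_neg_of_summable_abs hs
  have hS := ((h1.add h2).mul_left (x ^ 2))
  refine Summable.of_nonneg_of_le (fun k => by positivity) (fun k => ?_) hS
  have hck := hc ((k : ℤ) + 1)
  have hu := norm_nonneg (circleCoeff V ((k : ℤ) + 1))
  have hv := norm_nonneg (circleCoeff V (-((k : ℤ) + 1)))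
  have h0 := norm_nonneg (c ((k : ℤ) + 1))
  have hsq : ‖c ((k : ℤ) + 1)‖ ^ 2 ≤
      ‖circleCoeff V ((k : ℤ) + 1)‖ ^ 2 + ‖circleCoeff V (-((k : ℤ) + 1))‖ ^ 2 := by
    have hmul := mul_self_le_mul_self h0 hck
    nlinarith [sq_nonneg (‖circleCoeff V ((k : ℤ) + 1)‖ - ‖circleCoeff V (-((k : ℤ) + 1))‖)]
  have hk : (0 : ℝ) ≤ (k : ℝ) + 1 := by positivity
  calc ((k : ℝ) + 1) * (x * ‖c ((k : ℤ) + 1)‖) ^ 2 = x ^ 2 * (((k : ℝ) + 1) * ‖c ((k : ℤ) + 1)‖ ^ 2) := by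
        ring
    _ ≤ x ^ 2 * (((k : ℝ) + 1) * (‖circleCoeff V ((k : ℤ) + 1)‖ ^ 2 +
        ‖circleCoeff V (-((k : ℤ) + 1))‖ ^ 2)) := by gcongr
    _ = x ^ 2 * (((k : ℝ) + 1) * ‖circleCoeff V ((k : ℤ) + 1)‖ ^ 2 +
        ((k : ℝ) + 1) * ‖circleCoeff V (-((k : ℤ) + 1))‖ ^ 2) := by ring

/-- The Szegő sum of a real symbol is nonnegative. [folklore] -/
theorem szegoSum_nonneg (g : ℝ → ℝ) : 0 ≤ szegoSum g :=
  tsum_nonneg fun k => by positivity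

/-! #### The strong Szegő limit theorem for continuous complex symbols -/

/-- **The strong Szegő limit theorem** in the form of the tree's named fact
`Literature.Analysis.Toeplitz.strongSzego` (Deift–Its–Krasovsky 2013, §3, Theorem 7, for continuous
`2π`-periodic complex `V` with `∑ |k| |V_k|² < ∞`): `D_n(e^V)/e^{nV_0} → exp(∑_{k≥1} k V_k V_{-k})`.

Proof (operator-theory free). Real symbols: Fejér approximation of `V` by trigonometric polynomials,
for which the theorem is the tree's `strongSzego_geometric`; the passage to the limit uses the
log-convexity of `g ↦ D_n(e^g)` (Hölder in the Heine–Andréief integral) through Jensen's inequality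
`Φ_n(σ_N h) ≤ Φ_n(h)`, and the log-concavity of `n ↦ D_n` (monotonicity of `Φ_n` in `n`). Complex
symbols `V = A + iB`: the entire family `z ↦ F_n(A + zB)/exp(q(z))` is bounded by `e^{(Im z)² ∑ k|B_k|²}`
(`|D_n(f)| ≤ D_n(|f|)` and the real case) and tends to `1` on the real axis, hence at `z = i` by the
maximum modulus principle on a rectangle. [cite: DeiftItsKrasovsky2013, §3, Theorem 7] -/
theorem strongSzego_holds : strongSzego := by
  intro V hV hper hsV
  -- real and imaginary parts
  set A : ℝ → ℝ := fun θ => (V θ).re with hAdef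
  set B : ℝ → ℝ := fun θ => (V θ).im with hBdef
  have hA : Continuous A := Complex.continuous_re.comp hV
  have hB : Continuous B := Complex.continuous_im.comp hV
  have hAp : Function.Periodic A (2 * Real.pi) := fun θ => by simp [hAdef, hper θ]
  have hBp : Function.Periodic B (2 * Real.pi) := fun θ => by simp [hBdef, hper θ]
  have hVW : affSymbol A B I = V := by
    funext θ
    simp only [affSymbol, hAdef, hBdef]
    rw [mul_comm]
    exact Complex.re_add_im (V θ)
  -- coefficient sequences of `A` and `B`
  set a : ℤ → ℂ := circleCoeff (fun θ => (A θ : ℂ)) with hadef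
  set b : ℤ → ℂ := circleCoeff (fun θ => (B θ : ℂ)) with hbdef
  have hab : ∀ z m, circleCoeff (affSymbol A B z) m = a m + z * b m := fun z m =>
    circleCoeff_affSymbol hA hB z m
  have hVab : ∀ m, circleCoeff V m = a m + I * b m := fun m => by rw [← hVW]; exact hab I m
  have ha_neg : ∀ m, a (-m) = conj (a m) := fun m => (conj_circleCoeff_ofReal A m).symm
  have hb_neg : ∀ m, b (-m) = conj (b m) := fun m => (conj_circleCoeff_ofReal B m).symm
  have ha_le : ∀ m, ‖a m‖ ≤ (‖circleCoeff V m‖ + ‖circleCoeff V (-m)‖) / 2 :=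
    norm_circleCoeff_re_part_le hV
  have hb_le : ∀ m, ‖b m‖ ≤ (‖circleCoeff V m‖ + ‖circleCoeff V (-m)‖) / 2 :=
    norm_circleCoeff_im_part_le hV
  -- the real symbols `g_x = A + x B`
  have hg_coef : ∀ (x : ℝ) (m : ℤ),
      circleCoeff (fun θ => ((A θ + x * B θ : ℝ) : ℂ)) m = a m + x * b m := by
    intro x m; rw [← affSymbol_ofReal]; exact hab x m
  have hg_cont : ∀ x : ℝ, Continuous fun θ => A θ + x * B θ := fun x => by fun_prop
  have hg_per : ∀ x : ℝ, Function.Periodic (fun θ => A θ + x * B θ) (2 * Real.pi) := fun x θ => by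
    simp only [hAp θ, hBp θ]
  have hsa := summable_weighted_sq_of_le hsV ha_le 1
  have hsb : ∀ x : ℝ, Summable fun k : ℕ => ((k : ℝ) + 1) * (x * ‖b ((k : ℤ) + 1)‖) ^ 2 :=
    fun x => summable_weighted_sq_of_le hsV hb_le x
  have hg_sum : ∀ x : ℝ, Summable fun k : ℕ =>
      ((k : ℝ) + 1) * ‖circleCoeff (fun θ => ((A θ + x * B θ : ℝ) : ℂ)) ((k : ℤ) + 1)‖ ^ 2 := by
    intro x
    refine Summable.of_nonneg_of_le (fun k => by positivity) (fun k => ?_)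
      ((hsa.add (hsb x)).mul_left 2)
    rw [hg_coef]
    have htri := norm_add_le (a ((k : ℤ) + 1)) ((x : ℂ) * b ((k : ℤ) + 1))
    rw [norm_mul, Complex.norm_real, Real.norm_eq_abs] at htri
    have hk : (0 : ℝ) ≤ (k : ℝ) + 1 := by positivity
    have hu := norm_nonneg (a ((k : ℤ) + 1))
    have hv := norm_nonneg (b ((k : ℤ) + 1))
    have h0 := norm_nonneg (a ((k : ℤ) + 1) + (x : ℂ) * b ((k : ℤ) + 1))
    have hsq : ‖a ((k : ℤ) + 1) + (x : ℂ) * b ((k : ℤ) + 1)‖ ^ 2 ≤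
        2 * ((1 * ‖a ((k : ℤ) + 1)‖) ^ 2 + (x * ‖b ((k : ℤ) + 1)‖) ^ 2) := by
      have hmul := mul_self_le_mul_self h0 htri
      have h2 : (‖a ((k : ℤ) + 1)‖ + |x| * ‖b ((k : ℤ) + 1)‖) * (‖a ((k : ℤ) + 1)‖ + |x| * ‖b ((k : ℤ) + 1)‖) ≤
          2 * ((1 * ‖a ((k : ℤ) + 1)‖) ^ 2 + (x * ‖b ((k : ℤ) + 1)‖) ^ 2) := by
        have hx : (x * ‖b ((k : ℤ) + 1)‖) ^ 2 = (|x| * ‖b ((k : ℤ) + 1)‖) ^ 2 := by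
          rw [mul_pow, mul_pow, sq_abs]
        rw [hx]
        nlinarith [sq_nonneg (‖a ((k : ℤ) + 1)‖ - |x| * ‖b ((k : ℤ) + 1)‖)]
      calc ‖a ((k : ℤ) + 1) + (x : ℂ) * b ((k : ℤ) + 1)‖ ^ 2
          = ‖a ((k : ℤ) + 1) + (x : ℂ) * b ((k : ℤ) + 1)‖ * ‖a ((k : ℤ) + 1) + (x : ℂ) * b ((k : ℤ) + 1)‖ :=
            sq _
        _ ≤ _ := hmul.trans h2
    calc ((k : ℝ) + 1) * ‖a ((k : ℤ) + 1) + (x : ℂ) * b ((k : ℤ) + 1)‖ ^ 2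
        ≤ ((k : ℝ) + 1) * (2 * ((1 * ‖a ((k : ℤ) + 1)‖) ^ 2 + (x * ‖b ((k : ℤ) + 1)‖) ^ 2)) := by
          gcongr
      _ = 2 * (((k : ℝ) + 1) * (1 * ‖a ((k : ℤ) + 1)‖) ^ 2 +
          ((k : ℝ) + 1) * (x * ‖b ((k : ℤ) + 1)‖) ^ 2) := by ring
  -- the three moment sums and the quadratic polynomial `P`
  set f₀ : ℕ → ℂ := fun k => ((k : ℂ) + 1) * a ((k : ℤ) + 1) * a (-((k : ℤ) + 1)) with hf₀
  set f₁ : ℕ → ℂ := fun k => ((k : ℂ) + 1) * (a ((k : ℤ) + 1) * b (-((k : ℤ) + 1)) +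
    b ((k : ℤ) + 1) * a (-((k : ℤ) + 1))) with hf₁
  set f₂ : ℕ → ℂ := fun k => ((k : ℂ) + 1) * b ((k : ℤ) + 1) * b (-((k : ℤ) + 1)) with hf₂
  have hknorm : ∀ k : ℕ, ‖((k : ℂ) + 1)‖ = (k : ℝ) + 1 := fun k => by
    exact_mod_cast Complex.norm_natCast (k + 1)
  have hf₀s : Summable f₀ := by
    refine Summable.of_norm (hsa.congr fun k => ?_)
    rw [hf₀]; simp only
    rw [norm_mul, norm_mul, hknorm, ha_neg, Complex.norm_conj]; ring
  have hf₂s : Summable f₂ := by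
    refine Summable.of_norm ((hsb 1).congr fun k => ?_)
    rw [hf₂]; simp only
    rw [norm_mul, norm_mul, hknorm, hb_neg, Complex.norm_conj]; ring
  have hf₁s : Summable f₁ := by
    refine Summable.of_norm_bounded (hsa.add (hsb 1)) fun k => ?_
    rw [hf₁]; simp only
    rw [norm_mul, hknorm, ha_neg, hb_neg]
    have h1 : ‖a ((k : ℤ) + 1) * conj (b ((k : ℤ) + 1)) + b ((k : ℤ) + 1) * conj (a ((k : ℤ) + 1))‖ ≤
        2 * (‖a ((k : ℤ) + 1)‖ * ‖b ((k : ℤ) + 1)‖) := by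
      refine (norm_add_le _ _).trans ?_
      rw [norm_mul, norm_mul, Complex.norm_conj, Complex.norm_conj]; ring_nf; rfl
    have hk : (0 : ℝ) ≤ (k : ℝ) + 1 := by positivity
    calc ((k : ℝ) + 1) * ‖a ((k : ℤ) + 1) * conj (b ((k : ℤ) + 1)) + b ((k : ℤ) + 1) * conj (a ((k : ℤ) + 1))‖
        ≤ ((k : ℝ) + 1) * (2 * (‖a ((k : ℤ) + 1)‖ * ‖b ((k : ℤ) + 1)‖)) := by gcongr
      _ ≤ ((k : ℝ) + 1) * (1 * ‖a ((k : ℤ) + 1)‖) ^ 2 + ((k : ℝ) + 1) * (1 * ‖b ((k : ℤ) + 1)‖) ^ 2 := by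
          nlinarith [mul_nonneg hk (sq_nonneg (‖a ((k : ℤ) + 1)‖ - ‖b ((k : ℤ) + 1)‖))]
  set S₀ : ℂ := ∑' k, f₀ k with hS₀
  set S₁ : ℂ := ∑' k, f₁ k with hS₁
  set S₂ : ℂ := ∑' k, f₂ k with hS₂
  set P : ℂ → ℂ := fun z => S₀ + z * S₁ + z ^ 2 * S₂ with hPdef
  have hq : ∀ z : ℂ, HasSum (fun k : ℕ => ((k : ℂ) + 1) * (a ((k : ℤ) + 1) + z * b ((k : ℤ) + 1)) *
      (a (-((k : ℤ) + 1)) + z * b (-((k : ℤ) + 1)))) (P z) := by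
    intro z
    have h := (hf₀s.hasSum.add (hf₁s.hasSum.mul_left z)).add (hf₂s.hasSum.mul_left (z ^ 2))
    have hfun : (fun k : ℕ => ((k : ℂ) + 1) * (a ((k : ℤ) + 1) + z * b ((k : ℤ) + 1)) *
        (a (-((k : ℤ) + 1)) + z * b (-((k : ℤ) + 1)))) =
        fun k => f₀ k + z * f₁ k + z ^ 2 * f₂ k := by
      funext k; simp only [hf₀, hf₁, hf₂]; ring
    rw [hfun]
    exact h
  -- the normalised family `H_n(z) = F_n(W_z) e^{-P(z)}`
  set Hf : ℕ → ℂ → ℂ := fun n z => szegoQuot (affSymbol A B z) n * Complex.exp (-P z) with hHf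
  have hHd : ∀ n, Differentiable ℂ (Hf n) := fun n => by
    simp only [hHf, hPdef]
    exact (differentiable_szegoQuot_affSymbol hA hB n).mul (by fun_prop)
  -- `Re P(z) = ∑ k|(A + Re z B)_k|² - (Im z)² ∑ k|B_k|²`
  have hReP : ∀ z : ℂ, (P z).re = szegoSum (fun θ => A θ + z.re * B θ) - z.im ^ 2 * szegoSum B := by
    intro z
    rw [← (hq z).tsum_eq, Complex.re_tsum (hq z).summable]
    have hterm : ∀ k : ℕ, (((k : ℂ) + 1) * (a ((k : ℤ) + 1) + z * b ((k : ℤ) + 1)) *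
        (a (-((k : ℤ) + 1)) + z * b (-((k : ℤ) + 1)))).re =
        ((k : ℝ) + 1) * ‖a ((k : ℤ) + 1) + z.re * b ((k : ℤ) + 1)‖ ^ 2 -
          z.im ^ 2 * (((k : ℝ) + 1) * ‖b ((k : ℤ) + 1)‖ ^ 2) := by
      intro k
      rw [ha_neg, hb_neg]
      have h := re_weighted_term (a ((k : ℤ) + 1)) (b ((k : ℤ) + 1)) z ((k : ℝ) + 1)
      push_cast at h
      rw [h]; ring
    simp_rw [hterm]
    have hs1 : Summable fun k : ℕ => ((k : ℝ) + 1) * ‖a ((k : ℤ) + 1) + z.re * b ((k : ℤ) + 1)‖ ^ 2 :=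
      (hg_sum z.re).congr fun k => by rw [hg_coef]
    have hs2 : Summable fun k : ℕ => z.im ^ 2 * (((k : ℝ) + 1) * ‖b ((k : ℤ) + 1)‖ ^ 2) :=
      ((hsb 1).congr fun k => by ring).mul_left _
    rw [hs1.tsum_sub hs2, tsum_mul_left]
    congr 1
    unfold szegoSum
    exact tsum_congr fun k => by rw [hg_coef]
  -- the strip bound
  have hbound : ∀ n z, ‖Hf n z‖ ≤ Real.exp (szegoSum B * z.im ^ 2) := by
    intro n z
    simp only [hHf]
    rw [norm_mul, Complex.norm_exp, Complex.neg_re, hReP]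
    have h1 := norm_szegoQuot_affSymbol_le hA hB z n
    have h2 := logSzego_le_szegoSum (hg_cont z.re) (hg_per z.re) (hg_sum z.re) n
    calc ‖szegoQuot (affSymbol A B z) n‖ *
        Real.exp (-(szegoSum (fun θ => A θ + z.re * B θ) - z.im ^ 2 * szegoSum B))
        ≤ Real.exp (szegoSum fun θ => A θ + z.re * B θ) *
          Real.exp (-(szegoSum (fun θ => A θ + z.re * B θ) - z.im ^ 2 * szegoSum B)) := by
          gcongr
          exact h1.trans (Real.exp_le_exp.2 h2)
      _ = Real.exp (szegoSum B * z.im ^ 2) := by rw [← Real.exp_add]; congr 1; ring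
  -- convergence on the real axis
  have hreal : ∀ t : ℝ, Tendsto (fun n => Hf n t) atTop (𝓝 1) := by
    intro t
    have hPt : Complex.exp (P t) = ((Real.exp (szegoSum fun θ => A θ + t * B θ) : ℝ) : ℂ) := by
      rw [← (hq t).tsum_eq, ← szegoConst_ofReal (fun θ => A θ + t * B θ)]
      congr 1
      refine tsum_congr fun k => ?_
      rw [hg_coef, hg_coef]
    have hHt : ∀ n, Hf n t = ((Real.exp (logSzego n (fun θ => A θ + t * B θ) -
        szegoSum (fun θ => A θ + t * B θ)) : ℝ) : ℂ) := by
      intro n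
      simp only [hHf]
      rw [szegoQuot_affSymbol_ofReal hA hB t n, Complex.exp_neg, hPt, Real.exp_sub]
      push_cast
      ring
    simp_rw [hHt]
    rw [show (1 : ℂ) = ((Real.exp 0 : ℝ) : ℂ) by simp]
    refine (Complex.continuous_ofReal.tendsto _).comp ((Real.continuous_exp.tendsto _).comp ?_)
    have h := (tendsto_logSzego_szegoSum (hg_cont t) (hg_per t) (hg_sum t)).sub_const
      (szegoSum fun θ => A θ + t * B θ)
    rwa [sub_self] at h
  -- the two-constants lemma
  have hlim := tendsto_atI_of_strip_bound hHd (szegoSum_nonneg B) hbound hreal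
  -- unwinding at `z = i`
  have hPI : P I = ∑' k : ℕ, ((k : ℂ) + 1) * circleCoeff V ((k : ℤ) + 1) *
      circleCoeff V (-((k : ℤ) + 1)) := by
    rw [← (hq I).tsum_eq]
    refine tsum_congr fun k => ?_
    rw [hVab, hVab]
  have hF : ∀ n : ℕ, toeplitzDet (circleCoeff fun θ => Complex.exp (V θ)) n /
      Complex.exp (n * circleCoeff V 0) = Hf n I * Complex.exp (P I) := by
    intro n
    simp only [hHf]
    rw [mul_assoc, ← Complex.exp_add, neg_add_cancel, Complex.exp_zero, mul_one, hVW]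
    rfl
  simp_rw [hF]
  rw [← hPI]
  have h := hlim.mul_const (Complex.exp (P I))
  rwa [one_mul] at h

end ComplexCase

end Literature.Analysis.Toeplitz
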